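import Literature.Barriers.Parity.SiegelZeroDichotomyPairHLKernelRefined
import Literature.Barriers.Parity.SiegelZeroDichotomyPairHLProp81Model
import Literature.Barriers.Parity.SiegelZeroDichotomyPairHLProp81Singular
import Literature.Barriers.Parity.SiegelZeroDichotomyPairHLProp81Pointwise
import Literature.NumberTheory.LFunctions.SiegelZeroExceptionalPrimesSecond
import Literature.Barriers.Parity.SiegelZeroDichotomyChowlaStep5
import Mathlib.Analysis.SpecialFunctions.Log.Summable
import HarnessLib

/-!
# Tao–Teräväinen 2022, §8 (`k = 2`): the asymptotic (8.25) for the Euler product of the kernel (`KB3`)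

Topic `Literature/Barriers/Parity`, sub-namespace `TaoTeravainen`; the third kernel bound of the §8
assembly (`…Prop81Kernel.lean`, `…Prop81Final3.lean`), in the proof DAG of
`Literature.Barriers.Parity.TaoTeravainen2021_prop72_81_pair` (T. Tao, J. Teräväinen, *The
Hardy–Littlewood–Chowla conjecture in the presence of a Siegel zero*, J. London Math. Soc. (2) 106 (2022),
arXiv:2109.06291), §8 (8.21)–(8.25): on the regime (8.21) `|t| ≤ log^{1/(100k)} η`,
"`∏_p E_{p,t} = 𝔖 log^{-k}x ∏_j(1+t_{0,j}) + O(log^{-k} x/log^{1/(7k)} η)`" (8.25), obtained by comparing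
each `E_p` with the model `β_p ∏_j (1 − p^{-1-s_j})` — for `p ≥ C₀` with a RELATIVE error (8.23)–(8.24)
whose sum over `p` is `O(1/log^{1/(7k)} η)` ("using Corollary 3.6 to control the contribution of the
exceptional primes `p ≥ x^{1/√log η}`", Mertens' theorems (3.3), (3.5) for the rest), and for the boundedly
many `p < C₀` with an ABSOLUTE error `O(1/log^{1/(7k)} η)`. Here `k = 2`, the model product being written as
`𝔖'_x · ∏_j ∏_{p ≤ x}(1 − p^{-s(τ_{j,0})})` (`𝔖'_x` the partial singular series, `…Prop81Singular.lean`),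
which is the form consumed by the assembly. Everything is PROVED, with explicit (large) constants:

* generic comparisons `norm_prod_sub_prod_le_of_ratio` (`‖∏a − ∏b‖ ≤ ‖∏b‖(e^{∑‖a/b−1‖} − 1)`),
  `norm_prod_sub_prod_le_telescope`, `norm_prod_sub_prod_split`;
* one prime: `modelBeta` (`β_p`), `modelVal` (`b_p = β_p(1−u₀/p)(1−u₁/p)`), `norm_localE_sub_model_le`
  (`p ∤ Δ`: `‖E_p − b_p‖ ≤ 6αγ/p + 2α/p² + 8α/p³ + |1+χ(p)|(B₀+B₁)/p + 2(B₀+B₁)/p²`, from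
  `MainTerm.localE_sub_model_eq`), `norm_localE_sub_model_small_le` (any `p`: `≤ 480β + 36α`),
  `norm_inv_modelVal_le` (`‖b_p⁻¹‖ ≤ 7`, `p ≥ 3`), `norm_prod_localE_sub_prod_model_le` (the abstract
  two-block comparison), `singular_mul_eulerTrunc_eq_prod_modelVal` (`𝔖'·M = ∏ b_p`),
  `norm_prod_modelVal_big_le` (`‖∏_{p ≥ C₀} b_p‖ ≪ X^{-2}∏_j(1+X|τ_{j,0}|)²`, Mertens (3.2));
* the unit data of `assemblyKernel` (`uDat`, `vDat`) and their Taylor bounds, the per-prime majorant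
  `genericTerm` and its sum `sum_genericTerm_le ≤ Dbound` (the sums of `…MainTermSums.lean`; the primes
  `p > w` with `χ(p) = −1` contribute nothing), the fixed-`τ` comparison
  `norm_prod_localE_sub_prod_modelVal_dat_le`;
* the bookkeeping in `L = log η` (`kb3_Dbound_le`, `kb3_eterm_le`, `kb3_numerics`: every term is
  `≪ L^{-1/14}` on the box `|t| ≤ L^{1/200}`, with `log R = log x/L^{1/10}`, the cut `x^{1/√L}` of
  Corollary 3.6 (`TaoTeravainen2021_cor36_i_holds`, `ε = 40` since `x ≥ q^{41/2}`) and Siegel's bound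
  `L ≤ log q + c` (`exists_log_le_mul_log_conductor_add`));
* **`kernel_KB3`** — the bound in the exact form of the hypothesis `hKB3` of `prop72_81_pair_of_kernelBounds`
  (`κ = 2`). [cite: TaoTeravainen2021, §8 (8.21)–(8.25) and Corollary 3.6]
-/

noncomputable section

open Finset Real Complex

namespace Literature.Barriers.Parity

namespace TaoTeravainen

/-! ### Generic product comparisons -/

/-- **Relative comparison**: for `b_t ≠ 0`, `‖∏ a − ∏ b‖ ≤ ‖∏ b‖ · (exp(∑ ‖a_t/b_t − 1‖) − 1)`.
[folklore] -/
theorem norm_prod_sub_prod_le_of_ratio {ι : Type*} (T : Finset ι) (a b : ι → ℂ) (hb : ∀ t ∈ T, b t ≠ 0) :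
    ‖∏ t ∈ T, a t - ∏ t ∈ T, b t‖ ≤ ‖∏ t ∈ T, b t‖ * (Real.exp (∑ t ∈ T, ‖a t / b t - 1‖) - 1) := by
  classical
  have hprod : ∏ t ∈ T, a t = (∏ t ∈ T, b t) * ∏ t ∈ T, (1 + (a t / b t - 1)) := by
    rw [← prod_mul_distrib]
    refine prod_congr rfl fun t ht => ?_
    rw [add_sub_cancel, mul_div_cancel₀ _ (hb t ht)]
  rw [hprod, ← mul_sub_one, norm_mul]
  exact mul_le_mul_of_nonneg_left (Finset.norm_prod_one_add_sub_one_le T _) (norm_nonneg _)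

/-- **Telescoping comparison**: if `‖a_t‖, ‖b_t‖ ≤ M` on `T` with `M ≥ 1`, then
`‖∏_T a − ∏_T b‖ ≤ M^{#T} ∑_T ‖a_t − b_t‖`. [folklore] -/
theorem norm_prod_sub_prod_le_telescope {ι : Type*} (T : Finset ι) (a b : ι → ℂ) {M : ℝ} (hM : 1 ≤ M)
    (ha : ∀ t ∈ T, ‖a t‖ ≤ M) (hb : ∀ t ∈ T, ‖b t‖ ≤ M) :
    ‖∏ t ∈ T, a t - ∏ t ∈ T, b t‖ ≤ M ^ T.card * ∑ t ∈ T, ‖a t - b t‖ := by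
  classical
  induction T using Finset.induction_on with
  | empty => simp
  | insert x T hx ih =>
    have ha' : ∀ t ∈ T, ‖a t‖ ≤ M := fun t ht => ha t (mem_insert_of_mem ht)
    have hb' : ∀ t ∈ T, ‖b t‖ ≤ M := fun t ht => hb t (mem_insert_of_mem ht)
    have ih' := ih ha' hb'
    have hM0 : 0 ≤ M := by linarith
    have hPb : ‖∏ t ∈ T, b t‖ ≤ M ^ T.card := by
      rw [norm_prod]
      calc ∏ t ∈ T, ‖b t‖ ≤ ∏ t ∈ T, M := prod_le_prod (fun t _ => norm_nonneg _) hb'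
        _ = M ^ T.card := prod_const M
    rw [prod_insert hx, prod_insert hx, card_insert_of_notMem hx, sum_insert hx]
    have hsum0 : 0 ≤ ∑ t ∈ T, ‖a t - b t‖ := sum_nonneg fun t _ => norm_nonneg _
    calc ‖a x * ∏ t ∈ T, a t - b x * ∏ t ∈ T, b t‖
        = ‖a x * (∏ t ∈ T, a t - ∏ t ∈ T, b t) + (a x - b x) * ∏ t ∈ T, b t‖ := by ring_nf
      _ ≤ ‖a x‖ * ‖∏ t ∈ T, a t - ∏ t ∈ T, b t‖ + ‖a x - b x‖ * ‖∏ t ∈ T, b t‖ := by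
          refine (norm_add_le _ _).trans ?_; rw [norm_mul, norm_mul]
      _ ≤ M * (M ^ T.card * ∑ t ∈ T, ‖a t - b t‖) + ‖a x - b x‖ * M ^ T.card := by
          gcongr
          · exact ha x (mem_insert_self x T)
      _ ≤ M ^ (T.card + 1) * (‖a x - b x‖ + ∑ t ∈ T, ‖a t - b t‖) := by
          rw [pow_succ]
          have h1 : ‖a x - b x‖ * M ^ T.card ≤ M ^ T.card * M * ‖a x - b x‖ := by
            have := norm_nonneg (a x - b x)
            nlinarith [pow_nonneg hM0 T.card, mul_le_mul_of_nonneg_left hM (mul_nonneg (pow_nonneg hM0 T.card) this)]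
          nlinarith [h1, pow_nonneg hM0 T.card, hsum0]

/-- **Two-block combination**: `∏_S a ∏_B a − ∏_S b ∏_B b = ∏_S a (∏_B a − ∏_B b) + (∏_S a − ∏_S b) ∏_B b`, in norm.
[folklore] -/
theorem norm_prod_sub_prod_split (AS AB BS BB : ℂ) :
    ‖AS * AB - BS * BB‖ ≤ ‖AS‖ * ‖AB - BB‖ + ‖AS - BS‖ * ‖BB‖ := by
  calc ‖AS * AB - BS * BB‖ = ‖AS * (AB - BB) + (AS - BS) * BB‖ := by ring_nf
    _ ≤ ‖AS * (AB - BB)‖ + ‖(AS - BS) * BB‖ := norm_add_le _ _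
    _ = _ := by rw [norm_mul, norm_mul]

/-! ### One prime against the model (PART 2) -/

/-- The model factor at valuation data `v_H`: `(1 − 2/p + 1_{v_H ≥ 1}/p)·((1 − 1/p)⁻¹)² = β_p`
(`= E_p(1,1,1)·(1−1/p)^{-2}`, cf. `MainTerm.localE₀_eq`). [cite: TaoTeravainen2021, §8 ("β_p = (1 − m/p)(1 − 1/p)^{-k}")] -/
def modelBeta (p vH : ℕ) : ℂ :=
  (1 - 2 / (p : ℂ) + (if 1 ≤ vH then 1 / (p : ℂ) else 0)) * ((1 - 1 / (p : ℂ))⁻¹) ^ 2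

/-- **Generic primes (`p ∤ Δ`, `p ≥ 2`) against the model**: with `α ≥ ‖1 − u_j‖`, `‖u_j‖ ≤ 1`,
`‖v_{ij}‖ ≤ γ ≤ 1`, `B_j = ‖1−v₁ⱼ‖‖1−v₂ⱼ‖`,
`‖E_p − β_p (1 − u₀/p)(1 − u₁/p)‖ ≤ 6αγ/p + 2α/p² + 8α/p³ + |1+χ(p)|(B₀+B₁)/p + 2(B₀+B₁)/p²`.
[cite: TaoTeravainen2021, §8 (8.23)–(8.25)] -/
theorem norm_localE_sub_model_le {p : ℕ} (hp : 2 ≤ p) {L : ℕ} (hL : 1 ≤ L) {χp : ℝ} (hχ : |χp| ≤ 1)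
    {u v₁ v₂ : Fin 2 → ℂ} {α γ : ℝ} (hα : ∀ j, ‖1 - u j‖ ≤ α) (hu : ∀ j, ‖u j‖ ≤ 1) (hγ1 : γ ≤ 1)
    (hv₁ : ∀ j, ‖v₁ j‖ ≤ γ) (hv₂ : ∀ j, ‖v₂ j‖ ≤ γ) :
    ‖MainTerm.localE p 0 L χp u v₁ v₂ - modelBeta p 0 * ((1 - u 0 / p) * (1 - u 1 / p))‖ ≤
      6 * α * γ / p + 2 * α / (p : ℝ) ^ 2 + 8 * α / (p : ℝ) ^ 3 +
        |1 + χp| * (‖1 - v₁ 0‖ * ‖1 - v₂ 0‖ + ‖1 - v₁ 1‖ * ‖1 - v₂ 1‖) / p +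
        2 * (‖1 - v₁ 0‖ * ‖1 - v₂ 0‖ + ‖1 - v₁ 1‖ * ‖1 - v₂ 1‖) / (p : ℝ) ^ 2 := by
  have hp0 : (0 : ℝ) < p := by exact_mod_cast (show 0 < p by omega)
  have hnp : ‖(p : ℂ)‖ = p := Complex.norm_natCast p
  have hmodel : modelBeta p 0 * ((1 - u 0 / p) * (1 - u 1 / p)) =
      (1 - 2 / (p : ℂ)) * ((1 - 1 / (p : ℂ))⁻¹) ^ 2 * (1 - u 0 / p) * (1 - u 1 / p) := by
    unfold modelBeta; simp only [Nat.one_le_iff_ne_zero, ne_eq, not_true_eq_false, if_false, add_zero]; ring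
  rw [hmodel, MainTerm.localE_sub_model_eq hp hL χp u v₁ v₂]
  have hexc : ∀ j : Fin 2, ‖(1 + (χp : ℂ)) * u j * ((1 - v₁ j) * (1 - v₂ j)) / p‖ ≤ |1 + χp| * (‖1 - v₁ j‖ * ‖1 - v₂ j‖) / p := by
    intro j
    rw [norm_div, hnp, norm_mul, norm_mul, norm_mul, show (1 : ℂ) + χp = ((1 + χp : ℝ) : ℂ) by push_cast; ring,
      Complex.norm_real, Real.norm_eq_abs]
    refine div_le_div_of_nonneg_right ?_ hp0.le
    calc |1 + χp| * ‖u j‖ * (‖1 - v₁ j‖ * ‖1 - v₂ j‖) ≤ |1 + χp| * 1 * (‖1 - v₁ j‖ * ‖1 - v₂ j‖) := by gcongr; exact hu j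
      _ = _ := by ring
  have hg : ∀ j : Fin 2, ‖MainTerm.gTail p L χp (u j) (v₁ j) (v₂ j)‖ ≤ 2 * (‖1 - v₁ j‖ * ‖1 - v₂ j‖) / (p : ℝ) ^ 2 := by
    intro j
    refine (MainTerm.norm_gTail_le hp L hχ (hu j)).trans (le_of_eq ?_)
    rw [norm_mul]; ring
  calc ‖MainTerm.modelDelta p u v₁ v₂ + ∑ j : Fin 2, (1 + (χp : ℂ)) * u j * ((1 - v₁ j) * (1 - v₂ j)) / p +
        ∑ j : Fin 2, MainTerm.gTail p L χp (u j) (v₁ j) (v₂ j)‖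
      ≤ ‖MainTerm.modelDelta p u v₁ v₂‖ + ‖∑ j : Fin 2, (1 + (χp : ℂ)) * u j * ((1 - v₁ j) * (1 - v₂ j)) / p‖ +
        ‖∑ j : Fin 2, MainTerm.gTail p L χp (u j) (v₁ j) (v₂ j)‖ := (norm_add_le _ _).trans (add_le_add (norm_add_le _ _) le_rfl)
    _ ≤ (6 * α * γ / p + 2 * α / (p : ℝ) ^ 2 + 8 * α / (p : ℝ) ^ 3) +
        (|1 + χp| * (‖1 - v₁ 0‖ * ‖1 - v₂ 0‖) / p + |1 + χp| * (‖1 - v₁ 1‖ * ‖1 - v₂ 1‖) / p) +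
        (2 * (‖1 - v₁ 0‖ * ‖1 - v₂ 0‖) / (p : ℝ) ^ 2 + 2 * (‖1 - v₁ 1‖ * ‖1 - v₂ 1‖) / (p : ℝ) ^ 2) := by
        refine add_le_add (add_le_add (MainTerm.norm_modelDelta_le hp hα hu hγ1 hv₁ hv₂) ?_) ?_
        · rw [Fin.sum_univ_two]; exact (norm_add_le _ _).trans (add_le_add (hexc 0) (hexc 1))
        · rw [Fin.sum_univ_two]; exact (norm_add_le _ _).trans (add_le_add (hg 0) (hg 1))
    _ = _ := by ring

/-- **Small primes against the model** (`p ≥ 2`, any `v_H`, `L ≥ 1`): with `‖1 − v₁ⱼ‖ ≤ βv` and `‖1 − u_j‖ ≤ α`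
(`‖u‖, ‖v‖ ≤ 1`, `|χ(p)| ≤ 1`),
`‖E_p − β_p(1 − u₀/p)(1 − u₁/p)‖ ≤ 480 βv + 36 α`. [cite: TaoTeravainen2021, §8 (the primes `p < C₀`)] -/
theorem norm_localE_sub_model_small_le {p : ℕ} (hp : 2 ≤ p) (vH : ℕ) {L : ℕ} (hL : 1 ≤ L) {χp : ℝ} (hχ : |χp| ≤ 1)
    {u v₁ v₂ : Fin 2 → ℂ} (hu : ∀ j, ‖u j‖ ≤ 1) (hv₁ : ∀ j, ‖v₁ j‖ ≤ 1) (hv₂ : ∀ j, ‖v₂ j‖ ≤ 1)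
    {βv α : ℝ} (hβv : ∀ j, ‖1 - v₁ j‖ ≤ βv) (hα : ∀ j, ‖1 - u j‖ ≤ α) :
    ‖MainTerm.localE p vH L χp u v₁ v₂ - modelBeta p vH * ((1 - u 0 / p) * (1 - u 1 / p))‖ ≤ 480 * βv + 36 * α := by
  have hp0n : p ≠ 0 := by omega
  have hp0 : (0 : ℝ) < p := by exact_mod_cast (show 0 < p by omega)
  have hp2 : (2 : ℝ) ≤ p := by exact_mod_cast hp
  have hnp : ‖(p : ℂ)‖ = p := Complex.norm_natCast p
  have hα0 : 0 ≤ α := (norm_nonneg _).trans (hα 0)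
  -- `modelBeta · m = localE₀ · (w² m)` with `w = (1 − 1/p)⁻¹`
  set w : ℂ := (1 - 1 / (p : ℂ))⁻¹ with hw
  set m : ℂ := (1 - u 0 / p) * (1 - u 1 / p) with hm
  have hE0 : MainTerm.localE₀ p vH L = 1 - 2 / (p : ℂ) + (if 1 ≤ vH then 1 / (p : ℂ) else 0) := MainTerm.localE₀_eq hp0n vH hL
  have hmodel : modelBeta p vH * m = MainTerm.localE₀ p vH L * (w ^ 2 * m) := by
    rw [hE0]; unfold modelBeta; rw [hw]; ring
  -- `‖localE₀‖ ≤ 3`, `‖w‖ ≤ 2`, `‖w² m − 1‖ ≤ 4 · 3α/p`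
  have hE0n : ‖MainTerm.localE₀ p vH L‖ ≤ 3 := by
    rw [hE0]
    have h1 : ‖(1 : ℂ) - 2 / (p : ℂ)‖ ≤ 1 := by
      rw [show (1 : ℂ) - 2 / (p : ℂ) = (((1 - 2 / (p : ℝ) : ℝ)) : ℂ) by push_cast; ring, Complex.norm_real, Real.norm_eq_abs,
        abs_of_nonneg (by rw [sub_nonneg, div_le_one hp0]; exact hp2)]
      have : 0 ≤ 2 / (p : ℝ) := by positivity
      linarith
    have h2 : ‖(if 1 ≤ vH then 1 / (p : ℂ) else 0)‖ ≤ 1 := by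
      split_ifs
      · rw [norm_div, norm_one, hnp, div_le_one hp0]; linarith
      · simp
    calc _ ≤ ‖(1 : ℂ) - 2 / (p : ℂ)‖ + ‖(if 1 ≤ vH then 1 / (p : ℂ) else 0)‖ := norm_add_le _ _
      _ ≤ 1 + 1 := add_le_add h1 h2
      _ ≤ 3 := by norm_num
  have hwn : ‖w‖ ≤ 2 := by
    rw [hw, norm_inv]
    have h : (1 : ℝ) / 2 ≤ ‖(1 : ℂ) - 1 / (p : ℂ)‖ := by
      rw [show (1 : ℂ) - 1 / (p : ℂ) = (((1 - 1 / (p : ℝ) : ℝ)) : ℂ) by push_cast; ring, Complex.norm_real, Real.norm_eq_abs,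
        abs_of_nonneg (by rw [sub_nonneg, div_le_one hp0]; linarith)]
      have : 1 / (p : ℝ) ≤ 1 / 2 := div_le_div_of_nonneg_left zero_le_one two_pos hp2
      linarith
    calc ‖(1 : ℂ) - 1 / (p : ℂ)‖⁻¹ ≤ ((1 : ℝ) / 2)⁻¹ := inv_anti₀ (by norm_num) h
      _ = 2 := by norm_num
  have hmw : ‖w ^ 2 * m - 1‖ ≤ 12 * α := by
    -- `w² m − 1 = w² (m − (1 − 1/p)²)` since `w² (1 − 1/p)² = 1`
    have hpc : (p : ℂ) ≠ 0 := Nat.cast_ne_zero.mpr hp0n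
    have hsub : (1 : ℂ) - 1 / (p : ℂ) ≠ 0 := by
      intro h
      have := congr_arg norm h
      rw [norm_zero, show (1 : ℂ) - 1 / (p : ℂ) = (((1 - 1 / (p : ℝ) : ℝ)) : ℂ) by push_cast; ring, Complex.norm_real, Real.norm_eq_abs] at this
      have h2 : 1 / (p : ℝ) ≤ 1 / 2 := div_le_div_of_nonneg_left zero_le_one two_pos hp2
      have : (0 : ℝ) < |1 - 1 / (p : ℝ)| := abs_pos.mpr (by linarith)
      linarith
    have hid : w ^ 2 * m - 1 = w ^ 2 * (m - (1 - 1 / (p : ℂ)) ^ 2) := by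
      have hwq : w * (1 - 1 / (p : ℂ)) = 1 := by rw [hw]; exact inv_mul_cancel₀ hsub
      have e2 : w ^ 2 * (m - (1 - 1 / (p : ℂ)) ^ 2) = w ^ 2 * m - (w * (1 - 1 / (p : ℂ))) ^ 2 := by ring
      rw [e2, hwq, one_pow]
    rw [hid, norm_mul, norm_pow]
    -- `‖m − (1 − 1/p)²‖ ≤ 3α/p ≤ 3α/2`
    have hdiff : ‖m - (1 - 1 / (p : ℂ)) ^ 2‖ ≤ 3 * α / p := by
      have e : m - (1 - 1 / (p : ℂ)) ^ 2 = ((1 - u 0 / p) - (1 - 1 / p)) * (1 - u 1 / p) + (1 - 1 / (p : ℂ)) * ((1 - u 1 / p) - (1 - 1 / p)) := by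
        rw [hm]; ring
      have hd : ∀ j : Fin 2, ‖((1 : ℂ) - u j / p) - (1 - 1 / p)‖ ≤ α / p := fun j => by
        rw [show ((1 : ℂ) - u j / p) - (1 - 1 / p) = (1 - u j) / p by ring, norm_div, hnp]
        exact div_le_div_of_nonneg_right (hα j) hp0.le
      have hm1 : ‖(1 : ℂ) - u 1 / p‖ ≤ 2 := by
        calc ‖(1 : ℂ) - u 1 / p‖ ≤ ‖(1 : ℂ)‖ + ‖u 1 / (p : ℂ)‖ := norm_sub_le _ _
          _ ≤ 1 + 1 := by
              rw [norm_one, norm_div, hnp]; gcongr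
              calc ‖u 1‖ / (p : ℝ) ≤ 1 / p := div_le_div_of_nonneg_right (hu 1) hp0.le
                _ ≤ 1 := by rw [div_le_one hp0]; linarith
          _ = 2 := by norm_num
      have h1p : ‖(1 : ℂ) - 1 / (p : ℂ)‖ ≤ 1 := by
        rw [show (1 : ℂ) - 1 / (p : ℂ) = (((1 - 1 / (p : ℝ) : ℝ)) : ℂ) by push_cast; ring, Complex.norm_real, Real.norm_eq_abs,
          abs_of_nonneg (by rw [sub_nonneg, div_le_one hp0]; linarith)]
        have : 0 ≤ 1 / (p : ℝ) := by positivity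
        linarith
      rw [e]
      calc _ ≤ ‖((1 : ℂ) - u 0 / p) - (1 - 1 / p)‖ * ‖(1 : ℂ) - u 1 / p‖ + ‖(1 : ℂ) - 1 / (p : ℂ)‖ * ‖((1 : ℂ) - u 1 / p) - (1 - 1 / p)‖ := by
            refine (norm_add_le _ _).trans ?_; rw [norm_mul, norm_mul]
        _ ≤ (α / p) * 2 + 1 * (α / p) :=
            add_le_add (mul_le_mul (hd 0) hm1 (norm_nonneg _) (by positivity)) (mul_le_mul h1p (hd 1) (norm_nonneg _) zero_le_one)
        _ = 3 * α / p := by ring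
    have hdiff' : ‖m - (1 - 1 / (p : ℂ)) ^ 2‖ ≤ 3 * α := by
      refine hdiff.trans ?_
      rw [div_le_iff₀ hp0]; nlinarith
    calc ‖w‖ ^ 2 * ‖m - (1 - 1 / (p : ℂ)) ^ 2‖ ≤ 2 ^ 2 * (3 * α) :=
          mul_le_mul (pow_le_pow_left₀ (norm_nonneg _) hwn 2) hdiff' (norm_nonneg _) (by positivity)
      _ = 12 * α := by ring
  have hsplit : MainTerm.localE p vH L χp u v₁ v₂ - modelBeta p vH * m =
      (MainTerm.localE p vH L χp u v₁ v₂ - MainTerm.localE₀ p vH L) - MainTerm.localE₀ p vH L * (w ^ 2 * m - 1) := by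
    rw [hmodel]; ring
  rw [hsplit]
  calc _ ≤ ‖MainTerm.localE p vH L χp u v₁ v₂ - MainTerm.localE₀ p vH L‖ + ‖MainTerm.localE₀ p vH L * (w ^ 2 * m - 1)‖ := norm_sub_le _ _
    _ ≤ 480 * βv + 3 * (12 * α) := by
        rw [norm_mul]
        exact add_le_add (MainTerm.norm_localE_sub_localE₀_le hp vH L hχ hu hv₁ hv₂ hβv) (mul_le_mul hE0n hmw (norm_nonneg _) (by norm_num))
    _ = 480 * βv + 36 * α := by ring


/-! ### The abstract comparison of the product with the model (PART 2b) -/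

/-- The model value at a prime: `b_p = β_p · (1 − u₀/p)(1 − u₁/p)`. [cite: TaoTeravainen2021, §8 (8.25)] -/
def modelVal (p vH : ℕ) (u : Fin 2 → ℂ) : ℂ := modelBeta p vH * ((1 - u 0 / p) * (1 - u 1 / p))

/-- **The model is bounded below for generic primes**: `p ≥ 3`, `v_H = 0`, `‖u_j‖ ≤ 1` ⇒ `b_p ≠ 0` and
`‖b_p⁻¹‖ ≤ 7`. [folklore] -/
theorem norm_inv_modelVal_le {p : ℕ} (hp : 3 ≤ p) {u : Fin 2 → ℂ} (hu : ∀ j, ‖u j‖ ≤ 1) :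
    modelVal p 0 u ≠ 0 ∧ ‖(modelVal p 0 u)⁻¹‖ ≤ 7 := by
  have hp0 : (0 : ℝ) < p := by exact_mod_cast (show 0 < p by omega)
  have hp3 : (3 : ℝ) ≤ p := by exact_mod_cast hp
  have hnp : ‖(p : ℂ)‖ = p := Complex.norm_natCast p
  -- lower bounds for the factors
  have h1 : (1 : ℝ) / 3 ≤ ‖(1 : ℂ) - 2 / (p : ℂ)‖ := by
    rw [show (1 : ℂ) - 2 / (p : ℂ) = (((1 - 2 / (p : ℝ) : ℝ)) : ℂ) by push_cast; ring, Complex.norm_real, Real.norm_eq_abs,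
      abs_of_nonneg (by rw [sub_nonneg, div_le_one hp0]; linarith)]
    have : 2 / (p : ℝ) ≤ 2 / 3 := div_le_div_of_nonneg_left (by norm_num) (by norm_num) hp3
    linarith
  have h2 : (1 : ℝ) ≤ ‖((1 : ℂ) - 1 / (p : ℂ))⁻¹‖ := by
    rw [norm_inv]
    have hle : ‖(1 : ℂ) - 1 / (p : ℂ)‖ ≤ 1 := by
      rw [show (1 : ℂ) - 1 / (p : ℂ) = (((1 - 1 / (p : ℝ) : ℝ)) : ℂ) by push_cast; ring, Complex.norm_real, Real.norm_eq_abs,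
        abs_of_nonneg (by rw [sub_nonneg, div_le_one hp0]; linarith)]
      have : 0 ≤ 1 / (p : ℝ) := by positivity
      linarith
    have hpos : 0 < ‖(1 : ℂ) - 1 / (p : ℂ)‖ := by
      rw [show (1 : ℂ) - 1 / (p : ℂ) = (((1 - 1 / (p : ℝ) : ℝ)) : ℂ) by push_cast; ring, Complex.norm_real, Real.norm_eq_abs]
      refine abs_pos.mpr ?_
      have : 1 / (p : ℝ) ≤ 1 / 3 := div_le_div_of_nonneg_left zero_le_one (by norm_num) hp3
      linarith
    exact (one_le_inv₀ hpos).mpr hle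
  have h3 : ∀ j, (2 : ℝ) / 3 ≤ ‖(1 : ℂ) - u j / p‖ := fun j => by
    have hdiv : ‖u j / (p : ℂ)‖ ≤ 1 / 3 := by
      rw [norm_div, hnp]
      calc ‖u j‖ / (p : ℝ) ≤ 1 / p := div_le_div_of_nonneg_right (hu j) hp0.le
        _ ≤ 1 / 3 := div_le_div_of_nonneg_left zero_le_one (by norm_num) hp3
    have := norm_sub_norm_le (1 : ℂ) (u j / p)
    rw [norm_one] at this
    linarith
  have hnorm : (4 : ℝ) / 27 ≤ ‖modelVal p 0 u‖ := by
    unfold modelVal modelBeta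
    simp only [Nat.one_le_iff_ne_zero, ne_eq, not_true_eq_false, if_false, add_zero]
    rw [norm_mul, norm_mul, norm_mul, norm_pow]
    have hA : (1 : ℝ) / 3 * 1 ^ 2 ≤ ‖(1 : ℂ) - 2 / (p : ℂ)‖ * ‖((1 : ℂ) - 1 / (p : ℂ))⁻¹‖ ^ 2 :=
      mul_le_mul h1 (pow_le_pow_left₀ zero_le_one h2 2) (by positivity) (norm_nonneg _)
    have hB : (2 : ℝ) / 3 * (2 / 3) ≤ ‖(1 : ℂ) - u 0 / p‖ * ‖(1 : ℂ) - u 1 / p‖ :=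
      mul_le_mul (h3 0) (h3 1) (by positivity) (norm_nonneg _)
    calc (4 : ℝ) / 27 = ((1 : ℝ) / 3 * 1 ^ 2) * (2 / 3 * (2 / 3)) := by norm_num
      _ ≤ (‖(1 : ℂ) - 2 / (p : ℂ)‖ * ‖((1 : ℂ) - 1 / (p : ℂ))⁻¹‖ ^ 2) * (‖(1 : ℂ) - u 0 / p‖ * ‖(1 : ℂ) - u 1 / p‖) :=
          mul_le_mul hA hB (by positivity) (by positivity)
  have hne : modelVal p 0 u ≠ 0 := by
    intro h; rw [h, norm_zero] at hnorm; linarith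
  refine ⟨hne, ?_⟩
  rw [norm_inv]
  calc ‖modelVal p 0 u‖⁻¹ ≤ ((4 : ℝ) / 27)⁻¹ := inv_anti₀ (by norm_num) hnorm
    _ ≤ 7 := by norm_num

/-- Crude upper bounds: `‖b_p‖ ≤ 18 ≤ 972` for `p ≥ 2`, `‖u_j‖ ≤ 1` (any `v_H`). [folklore] -/
theorem norm_modelVal_le {p : ℕ} (hp : 2 ≤ p) (vH : ℕ) {u : Fin 2 → ℂ} (hu : ∀ j, ‖u j‖ ≤ 1) :
    ‖modelVal p vH u‖ ≤ 18 := by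
  have hp0 : (0 : ℝ) < p := by exact_mod_cast (show 0 < p by omega)
  have hp2 : (2 : ℝ) ≤ p := by exact_mod_cast hp
  have hnp : ‖(p : ℂ)‖ = p := Complex.norm_natCast p
  unfold modelVal modelBeta
  rw [norm_mul, norm_mul, norm_mul, norm_pow]
  have hA : ‖(1 : ℂ) - 2 / (p : ℂ) + (if 1 ≤ vH then 1 / (p : ℂ) else 0)‖ ≤ 2 := by
    have h1 : ‖(1 : ℂ) - 2 / (p : ℂ)‖ ≤ 1 := by
      rw [show (1 : ℂ) - 2 / (p : ℂ) = (((1 - 2 / (p : ℝ) : ℝ)) : ℂ) by push_cast; ring, Complex.norm_real, Real.norm_eq_abs,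
        abs_of_nonneg (by rw [sub_nonneg, div_le_one hp0]; exact hp2)]
      have : 0 ≤ 2 / (p : ℝ) := by positivity
      linarith
    have h2 : ‖(if 1 ≤ vH then 1 / (p : ℂ) else 0)‖ ≤ 1 := by
      split_ifs
      · rw [norm_div, norm_one, hnp, div_le_one hp0]; linarith
      · simp
    linarith [norm_add_le ((1 : ℂ) - 2 / (p : ℂ)) (if 1 ≤ vH then 1 / (p : ℂ) else 0)]
  have hB : ‖((1 : ℂ) - 1 / (p : ℂ))⁻¹‖ ≤ 2 := by
    rw [norm_inv]
    have h : (1 : ℝ) / 2 ≤ ‖(1 : ℂ) - 1 / (p : ℂ)‖ := by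
      rw [show (1 : ℂ) - 1 / (p : ℂ) = (((1 - 1 / (p : ℝ) : ℝ)) : ℂ) by push_cast; ring, Complex.norm_real, Real.norm_eq_abs,
        abs_of_nonneg (by rw [sub_nonneg, div_le_one hp0]; linarith)]
      have : 1 / (p : ℝ) ≤ 1 / 2 := div_le_div_of_nonneg_left zero_le_one two_pos hp2
      linarith
    calc ‖(1 : ℂ) - 1 / (p : ℂ)‖⁻¹ ≤ ((1 : ℝ) / 2)⁻¹ := inv_anti₀ (by norm_num) h
      _ = 2 := by norm_num
  have hC : ∀ j, ‖(1 : ℂ) - u j / p‖ ≤ 3 / 2 := fun j => by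
    calc ‖(1 : ℂ) - u j / p‖ ≤ ‖(1 : ℂ)‖ + ‖u j / (p : ℂ)‖ := norm_sub_le _ _
      _ ≤ 1 + 1 / 2 := by
          rw [norm_one, norm_div, hnp]
          have : ‖u j‖ / (p : ℝ) ≤ 1 / 2 := by
            calc ‖u j‖ / (p : ℝ) ≤ 1 / p := div_le_div_of_nonneg_right (hu j) hp0.le
              _ ≤ 1 / 2 := div_le_div_of_nonneg_left zero_le_one two_pos hp2
          linarith
      _ = 3 / 2 := by norm_num
  calc ‖(1 : ℂ) - 2 / (p : ℂ) + (if 1 ≤ vH then 1 / (p : ℂ) else 0)‖ * ‖((1 : ℂ) - 1 / (p : ℂ))⁻¹‖ ^ 2 *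
        (‖(1 : ℂ) - u 0 / p‖ * ‖(1 : ℂ) - u 1 / p‖) ≤ 2 * 2 ^ 2 * (3 / 2 * (3 / 2)) := by
        refine mul_le_mul (mul_le_mul hA (pow_le_pow_left₀ (norm_nonneg _) hB 2) (by positivity) (by norm_num))
          (mul_le_mul (hC 0) (hC 1) (norm_nonneg _) (by norm_num)) (by positivity) (by positivity)
    _ = 18 := by norm_num

/-- **The abstract comparison.** Let `P` be a finite set of primes, `Δ ≠ 0`, `L ≥ 1`, `C₀` such that the
primes `p ≥ C₀` of `P` do not divide `Δ` and are `≥ 3`; side data of norm `≤ 1`, `|χ(p)| ≤ 1`; per-prime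
bounds `‖E_p − b_p‖ ≤ d_p` (`p ≥ C₀`) and `‖E_p − b_p‖ ≤ e` (`p < C₀`). Then
`‖∏_P E_p − ∏_P b_p‖ ≤ 972^{C₀} · ‖∏_{P, p ≥ C₀} b_p‖ · (exp(7 ∑_{p ≥ C₀} d_p) − 1 + C₀ · e)`.
[cite: TaoTeravainen2021, §8 (8.21)–(8.25)] -/
theorem norm_prod_localE_sub_prod_model_le {P : Finset ℕ} (hP : ∀ p ∈ P, p.Prime) {Δ : ℕ} {L : ℕ}
    {C₀ : ℕ} (hC₀ : ∀ p ∈ P, C₀ ≤ p → ¬p ∣ Δ ∧ 3 ≤ p)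
    (χp : ℕ → ℝ) (hχ : ∀ p, |χp p| ≤ 1) (u v₁ v₂ : ℕ → Fin 2 → ℂ)
    (hu : ∀ p j, ‖u p j‖ ≤ 1) (hv₁ : ∀ p j, ‖v₁ p j‖ ≤ 1) (hv₂ : ∀ p j, ‖v₂ p j‖ ≤ 1)
    {d : ℕ → ℝ} (hd : ∀ p ∈ P, C₀ ≤ p →
      ‖MainTerm.localE p (Δ.factorization p) L (χp p) (u p) (v₁ p) (v₂ p) - modelVal p (Δ.factorization p) (u p)‖ ≤ d p)
    {e : ℝ} (he0 : 0 ≤ e) (he : ∀ p ∈ P, p < C₀ →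
      ‖MainTerm.localE p (Δ.factorization p) L (χp p) (u p) (v₁ p) (v₂ p) - modelVal p (Δ.factorization p) (u p)‖ ≤ e) :
    ‖∏ p ∈ P, MainTerm.localE p (Δ.factorization p) L (χp p) (u p) (v₁ p) (v₂ p) - ∏ p ∈ P, modelVal p (Δ.factorization p) (u p)‖ ≤
      972 ^ C₀ * ‖∏ p ∈ P.filter (fun p => C₀ ≤ p), modelVal p (Δ.factorization p) (u p)‖ *
        (Real.exp (7 * ∑ p ∈ P.filter (fun p => C₀ ≤ p), d p) - 1 + C₀ * e) := by
  classical
  set Psm := P.filter (fun p => ¬C₀ ≤ p) with hPsm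
  set Pbg := P.filter (fun p => C₀ ≤ p) with hPbg
  set E : ℕ → ℂ := fun p => MainTerm.localE p (Δ.factorization p) L (χp p) (u p) (v₁ p) (v₂ p) with hE
  set b : ℕ → ℂ := fun p => modelVal p (Δ.factorization p) (u p) with hb
  have hsplitE : ∏ p ∈ P, E p = (∏ p ∈ Psm, E p) * ∏ p ∈ Pbg, E p := by
    rw [hPsm, hPbg, mul_comm, prod_filter_mul_prod_filter_not]
  have hsplitb : ∏ p ∈ P, b p = (∏ p ∈ Psm, b p) * ∏ p ∈ Pbg, b p := by
    rw [hPsm, hPbg, mul_comm, prod_filter_mul_prod_filter_not]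
  -- big primes: ratio lemma
  have hbig : ‖∏ p ∈ Pbg, E p - ∏ p ∈ Pbg, b p‖ ≤ ‖∏ p ∈ Pbg, b p‖ * (Real.exp (7 * ∑ p ∈ Pbg, d p) - 1) := by
    have hb0 : ∀ p ∈ Pbg, b p ≠ 0 := by
      intro p hp
      rw [hPbg, mem_filter] at hp
      obtain ⟨hnd, h3⟩ := hC₀ p hp.1 hp.2
      rw [hb]; simp only
      rw [Nat.factorization_eq_zero_of_not_dvd hnd]
      exact (norm_inv_modelVal_le h3 (hu p)).1
    refine (norm_prod_sub_prod_le_of_ratio Pbg E b hb0).trans (mul_le_mul_of_nonneg_left ?_ (norm_nonneg _))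
    refine sub_le_sub_right (Real.exp_le_exp.mpr ?_) 1
    rw [mul_sum]
    refine sum_le_sum fun p hp => ?_
    rw [hPbg, mem_filter] at hp
    obtain ⟨hnd, h3⟩ := hC₀ p hp.1 hp.2
    have hvH : Δ.factorization p = 0 := Nat.factorization_eq_zero_of_not_dvd hnd
    obtain ⟨hne, hinv⟩ := norm_inv_modelVal_le h3 (hu p)
    have hdp := hd p hp.1 hp.2
    rw [hvH] at hdp
    calc ‖E p / b p - 1‖ = ‖(E p - b p) * (b p)⁻¹‖ := by
          rw [hE, hb]; simp only; rw [hvH, sub_mul, mul_inv_cancel₀ hne, div_eq_mul_inv]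
      _ ≤ d p * 7 := by
          rw [norm_mul, hE, hb]; simp only; rw [hvH]
          exact mul_le_mul hdp hinv (norm_nonneg _) ((norm_nonneg _).trans hdp)
      _ = 7 * d p := mul_comm _ _
  -- small primes: telescoping with `M = 972`
  have hsmall_card : Psm.card ≤ C₀ := by
    have hsub : Psm ⊆ Finset.range C₀ := by
      intro p hp; rw [hPsm, mem_filter] at hp; exact mem_range.mpr (not_le.mp hp.2)
    exact (card_le_card hsub).trans (card_range C₀).le
  have hEbd : ∀ p ∈ P, ‖E p‖ ≤ 972 := fun p hp =>
    norm_localE_le_crude (hP p hp).two_le _ _ (hχ p) (hu p) (hv₁ p) (hv₂ p)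
  have hbbd : ∀ p ∈ P, ‖b p‖ ≤ 972 := fun p hp =>
    (norm_modelVal_le (hP p hp).two_le _ (hu p)).trans (by norm_num)
  have hsmall : ‖∏ p ∈ Psm, E p - ∏ p ∈ Psm, b p‖ ≤ 972 ^ C₀ * (C₀ * e) := by
    have h := norm_prod_sub_prod_le_telescope Psm E b (by norm_num : (1 : ℝ) ≤ 972)
      (fun p hp => hEbd p (mem_filter.mp hp).1) (fun p hp => hbbd p (mem_filter.mp hp).1)
    refine h.trans ?_
    have hsum : ∑ p ∈ Psm, ‖E p - b p‖ ≤ C₀ * e := by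
      calc ∑ p ∈ Psm, ‖E p - b p‖ ≤ ∑ p ∈ Psm, e := sum_le_sum fun p hp => by
            rw [hPsm, mem_filter] at hp; exact he p hp.1 (not_le.mp hp.2)
        _ = Psm.card * e := by rw [sum_const, nsmul_eq_mul]
        _ ≤ C₀ * e := mul_le_mul_of_nonneg_right (by exact_mod_cast hsmall_card) he0
    exact mul_le_mul (pow_le_pow_right₀ (by norm_num) hsmall_card) hsum (sum_nonneg fun _ _ => norm_nonneg _) (by positivity)
  have hsmE : ‖∏ p ∈ Psm, E p‖ ≤ 972 ^ C₀ := by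
    rw [norm_prod]
    refine (prod_le_prod (fun p _ => norm_nonneg _) (fun p hp => hEbd p (mem_filter.mp hp).1)).trans ?_
    rw [prod_const]
    exact pow_le_pow_right₀ (by norm_num) hsmall_card
  -- combine
  rw [hsplitE, hsplitb]
  have hexp0 : 0 ≤ Real.exp (7 * ∑ p ∈ Pbg, d p) - 1 := by
    have : 0 ≤ ∑ p ∈ Pbg, d p := sum_nonneg fun p hp => by
      rw [hPbg, mem_filter] at hp; exact (norm_nonneg _).trans (hd p hp.1 hp.2)
    have := Real.one_le_exp (by positivity : 0 ≤ 7 * ∑ p ∈ Pbg, d p)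
    linarith
  calc ‖(∏ p ∈ Psm, E p) * ∏ p ∈ Pbg, E p - (∏ p ∈ Psm, b p) * ∏ p ∈ Pbg, b p‖
      ≤ ‖∏ p ∈ Psm, E p‖ * ‖∏ p ∈ Pbg, E p - ∏ p ∈ Pbg, b p‖ + ‖∏ p ∈ Psm, E p - ∏ p ∈ Psm, b p‖ * ‖∏ p ∈ Pbg, b p‖ :=
        norm_prod_sub_prod_split _ _ _ _
    _ ≤ 972 ^ C₀ * (‖∏ p ∈ Pbg, b p‖ * (Real.exp (7 * ∑ p ∈ Pbg, d p) - 1)) + (972 ^ C₀ * (C₀ * e)) * ‖∏ p ∈ Pbg, b p‖ := by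
        gcongr
    _ = 972 ^ C₀ * ‖∏ p ∈ Pbg, b p‖ * (Real.exp (7 * ∑ p ∈ Pbg, d p) - 1 + C₀ * e) := by ring


/-! ### The model at the data of the assembly (PART 2c) -/

/-- `β_p` is the `p`-th factor of the singular series of `{h₁, h₂}` (as a complex number), at
`v_H = v_p(|h₁ − h₂|)`, for `p` prime. [cite: TaoTeravainen2021, §8 ("β_p = (1 − m/p)(1 − 1/p)^{-k}")] -/
theorem modelBeta_eq_singularSeriesFactor {h₁ h₂ : ℕ} (hne : h₁ ≠ h₂) {p : ℕ} (hp : p.Prime) :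
    modelBeta p ((shiftDiff h₁ h₂).factorization p) =
      ((Literature.NumberTheory.Sieve.singularSeriesFactor ({(h₁ : ℤ), (h₂ : ℤ)} : Finset ℤ) p : ℝ) : ℂ) := by
  have hab : (h₁ : ℤ) ≠ h₂ := by exact_mod_cast hne
  rw [singularSeriesFactor_pair_complex hab]
  have hiff : (p : ℤ) ∣ (h₁ : ℤ) - h₂ ↔ 1 ≤ (shiftDiff h₁ h₂).factorization p := by
    rw [Int.ofNat_dvd_left, ← hp.dvd_iff_one_le_factorization (shiftDiff_ne_zero hne)]
    rfl
  unfold modelBeta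
  by_cases h : (p : ℤ) ∣ (h₁ : ℤ) - h₂
  · rw [if_pos (hiff.mp h), if_pos h]; ring
  · rw [if_neg (fun h' => h (hiff.mpr h')), if_neg h]; ring

/-- **`𝔖' · M(τ) = ∏_{p ≤ x} b_p`**: the partial singular series times the two truncated Euler products is
the product of the model values. [cite: TaoTeravainen2021, §8 (8.25)] -/
theorem singular_mul_eulerTrunc_eq_prod_modelVal {h₁ h₂ : ℕ} (hne : h₁ ≠ h₂) (x : ℕ) (X R : ℝ) (τ : Slot → ℝ) :
    ((Literature.NumberTheory.Sieve.singularSeriesPartial ({(h₁ : ℤ), (h₂ : ℤ)} : Finset ℤ) x : ℝ) : ℂ) *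
        ∏ j : Fin 2, eulerTrunc (x + 1) (zetaSlotS X (τ (j, 0))) =
      ∏ p ∈ Nat.primesBelow (x + 1), modelVal p ((shiftDiff h₁ h₂).factorization p)
        (fun j => npow (slotExpo X R (j, 0) (τ (j, 0))) p) := by
  have hS := singularSeriesPartial_eq_prod_primesBelow ({(h₁ : ℤ), (h₂ : ℤ)} : Finset ℤ) (by omega : 1 ≤ x + 1)
  rw [Nat.add_sub_cancel] at hS
  rw [hS, Complex.ofReal_prod]
  unfold eulerTrunc
  rw [Finset.prod_comm, ← prod_mul_distrib]
  refine prod_congr rfl fun p hp => ?_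
  have hpr := Nat.prime_of_mem_primesBelow hp
  rw [← modelBeta_eq_singularSeriesFactor hne hpr]
  unfold modelVal
  rw [Fin.prod_univ_two, npow_slotExpo_div_eq_cpow X R 0 _ hpr.pos, npow_slotExpo_div_eq_cpow X R 1 _ hpr.pos]

/-- `0 ≤ β_p ≤ 1` in norm for generic primes: `‖modelBeta p 0‖ ≤ 1` (`p ≥ 2`). [folklore] -/
theorem norm_modelBeta_zero_le {p : ℕ} (hp : 2 ≤ p) : ‖modelBeta p 0‖ ≤ 1 := by
  have hp0 : (0 : ℝ) < p := by exact_mod_cast (show 0 < p by omega)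
  have hp2 : (2 : ℝ) ≤ p := by exact_mod_cast hp
  unfold modelBeta
  simp only [Nat.one_le_iff_ne_zero, ne_eq, not_true_eq_false, if_false, add_zero]
  have hreal : (1 - 2 / (p : ℂ)) * ((1 - 1 / (p : ℂ))⁻¹) ^ 2 = ((((p : ℝ) ^ 2 - 2 * p) / ((p : ℝ) - 1) ^ 2 : ℝ) : ℂ) := by
    have hp1 : (p : ℂ) - 1 ≠ 0 := by
      intro h
      have : (p : ℂ) = 1 := by linear_combination h
      have : (p : ℝ) = 1 := by exact_mod_cast this
      linarith
    have hpc : (p : ℂ) ≠ 0 := Nat.cast_ne_zero.mpr (by omega)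
    push_cast
    field_simp
  rw [hreal, Complex.norm_real, Real.norm_eq_abs, abs_of_nonneg (div_nonneg (by nlinarith) (sq_nonneg _)),
    div_le_one (by nlinarith)]
  nlinarith

/-- **The model product over the generic primes is `O(X^{-2})`**: for `X = log x ≥ 2`, `3 ≤ C₀ ≤ x`,
all primes `p ≥ C₀` below `x + 1` not dividing `Δ`:
`‖∏_{C₀ ≤ p ≤ x} b_p‖ ≤ (2π)^4 e^{2c(C₀)} X^{-2} ∏_j (1 + X|τ_{j0}|)²`, `c(C₀) = log log C₀ + 6/log C₀ + 77`.
[cite: TaoTeravainen2021, §3.1 (3.2), §8 (8.25)] -/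
theorem norm_prod_modelVal_big_le {Δ : ℕ} {C₀ : ℕ} (hC₀ : 3 ≤ C₀) {x : ℕ} (hC₀x : C₀ ≤ x) (hX : 2 ≤ Real.log x)
    (hgen : ∀ p ∈ Nat.primesBelow (x + 1), C₀ ≤ p → ¬p ∣ Δ) (R : ℝ) (τ : Slot → ℝ) :
    ‖∏ p ∈ (Nat.primesBelow (x + 1)).filter (fun p => C₀ ≤ p), modelVal p (Δ.factorization p)
        (fun j => npow (slotExpo (Real.log x) R (j, 0) (τ (j, 0))) p)‖ ≤
      (2 * π) ^ 4 * Real.exp (Real.log (Real.log C₀) + 6 / Real.log C₀ + 77) ^ 2 * (Real.log x ^ 2)⁻¹ *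
        ∏ j : Fin 2, (1 + Real.log x * |τ (j, 0)|) ^ 2 := by
  set X := Real.log x with hXdef
  set P := Nat.primesBelow (x + 1) with hP
  set c := Real.log (Real.log C₀) + 6 / Real.log C₀ + 77 with hc
  have hX0 : 0 < X := by linarith
  have hx0 : (0 : ℝ) < x := by
    have : (3 : ℝ) ≤ x := by exact_mod_cast hC₀.trans hC₀x
    linarith
  have hexpX : Real.exp X = x := by rw [hXdef, Real.exp_log hx0]
  have hPp : ∀ p ∈ P, p.Prime := fun p hp => Nat.prime_of_mem_primesBelow hp
  have hπ := Real.pi_gt_three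
  -- split `modelVal = β · ∏_j (1 − p^{-s_j})`
  have hsplit : ∏ p ∈ P.filter (fun p => C₀ ≤ p), modelVal p (Δ.factorization p) (fun j => npow (slotExpo X R (j, 0) (τ (j, 0))) p) =
      (∏ p ∈ P.filter (fun p => C₀ ≤ p), modelBeta p 0) *
        ∏ j : Fin 2, ∏ p ∈ P.filter (fun p => C₀ ≤ p), (1 - (p : ℂ) ^ (-zetaSlotS X (τ (j, 0)))) := by
    rw [Finset.prod_comm, ← prod_mul_distrib]
    refine prod_congr rfl fun p hp => ?_
    rw [mem_filter] at hp
    have hpr := hPp p hp.1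
    unfold modelVal
    rw [Nat.factorization_eq_zero_of_not_dvd (hgen p hp.1 hp.2), Fin.prod_univ_two,
      npow_slotExpo_div_eq_cpow X R 0 _ hpr.pos, npow_slotExpo_div_eq_cpow X R 1 _ hpr.pos]
  rw [hsplit, norm_mul, norm_prod, Complex.norm_prod]
  -- `‖∏ β‖ ≤ 1`
  have hβ : ∏ p ∈ P.filter (fun p => C₀ ≤ p), ‖modelBeta p 0‖ ≤ 1 := by
    calc ∏ p ∈ P.filter (fun p => C₀ ≤ p), ‖modelBeta p 0‖ ≤ ∏ p ∈ P.filter (fun p => C₀ ≤ p), (1 : ℝ) :=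
          prod_le_prod (fun p _ => norm_nonneg _) (fun p hp => norm_modelBeta_zero_le (hPp p (mem_filter.mp hp).1).two_le)
      _ = 1 := prod_const_one
  -- each Euler slot
  have hslot : ∀ j : Fin 2, ‖∏ p ∈ P.filter (fun p => C₀ ≤ p), (1 - (p : ℂ) ^ (-zetaSlotS X (τ (j, 0))))‖ ≤
      (2 * π) ^ 2 * Real.exp c * (1 + X * |τ (j, 0)|) ^ 2 / X := by
    intro j
    obtain ⟨hs, hre, hnorm⟩ := zetaSlotS_eq X (τ (j, 0)) hX0
    have hσ : (1 : ℝ) ≤ 1 + 2 * π * X * |τ (j, 0)| := by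
      have := abs_nonneg (τ (j, 0))
      have h2 : 0 ≤ 2 * π * X * |τ (j, 0)| := by positivity
      linarith
    have hPsup : ∀ p : ℕ, p.Prime → C₀ ≤ p → (p : ℝ) ≤ Real.exp X → p ∈ P := by
      intro p hp _ hpx
      rw [hexpX] at hpx
      exact Nat.mem_primesBelow.mpr ⟨by exact_mod_cast (show (p : ℝ) < x + 1 by linarith), hp⟩
    have h := MainTerm.norm_prod_one_sub_cpow_le hPp (by omega : 2 ≤ C₀) hX hσ
      (by rw [hexpX]; exact_mod_cast hC₀x) hPsup hre hnorm
    rw [hs]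
    refine h.trans ?_
    rw [← hc, div_le_div_iff_of_pos_right hX0]
    have hsq : (1 + 2 * π * X * |τ (j, 0)|) ^ 2 ≤ (2 * π) ^ 2 * (1 + X * |τ (j, 0)|) ^ 2 := by
      rw [← mul_pow]
      refine pow_le_pow_left₀ (by linarith) ?_ 2
      have := abs_nonneg (τ (j, 0)); nlinarith
    calc Real.exp c * (1 + 2 * π * X * |τ (j, 0)|) ^ 2 ≤ Real.exp c * ((2 * π) ^ 2 * (1 + X * |τ (j, 0)|) ^ 2) :=
          mul_le_mul_of_nonneg_left hsq (Real.exp_pos c).le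
      _ = (2 * π) ^ 2 * Real.exp c * (1 + X * |τ (j, 0)|) ^ 2 := by ring
  have hprod : ∏ j : Fin 2, ‖∏ p ∈ P.filter (fun p => C₀ ≤ p), (1 - (p : ℂ) ^ (-zetaSlotS X (τ (j, 0))))‖ ≤
      ∏ j : Fin 2, ((2 * π) ^ 2 * Real.exp c * (1 + X * |τ (j, 0)|) ^ 2 / X) :=
    prod_le_prod (fun j _ => norm_nonneg _) (fun j _ => hslot j)
  calc (∏ p ∈ P.filter (fun p => C₀ ≤ p), ‖modelBeta p 0‖) *
        ∏ j : Fin 2, ‖∏ p ∈ P.filter (fun p => C₀ ≤ p), (1 - (p : ℂ) ^ (-zetaSlotS X (τ (j, 0))))‖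
      ≤ 1 * ∏ j : Fin 2, ((2 * π) ^ 2 * Real.exp c * (1 + X * |τ (j, 0)|) ^ 2 / X) :=
        mul_le_mul hβ hprod (prod_nonneg fun j _ => norm_nonneg _) zero_le_one
    _ = (2 * π) ^ 4 * Real.exp c ^ 2 * (X ^ 2)⁻¹ * ∏ j : Fin 2, (1 + X * |τ (j, 0)|) ^ 2 := by
        rw [Fin.prod_univ_two, Fin.prod_univ_two]; field_simp



/-! ### The unit data of the assembly kernel (PART 3a) -/

variable {q : ℕ}

/-- The `d`-slot units of the kernel at `τ`: `u_p(j) = p^{s₀(τ_{j,0})}`, `s₀(t) = -1/X + 2πit`.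
[cite: TaoTeravainen2021, §8 (8.17)] -/
def uDat (X R : ℝ) (τ : Slot → ℝ) (p : ℕ) (j : Fin 2) : ℂ := npow (slotExpo X R (j, 0) (τ (j, 0))) p

/-- The sieve-slot units of the kernel at `τ`: `v_{i,p}(j) = p^{s_i(τ_{j,i})}`, `s_i(t) = (-1 + 2πit)/log R`.
[cite: TaoTeravainen2021, §8 (8.17)] -/
def vDat (X R : ℝ) (τ : Slot → ℝ) (i : Fin 3) (p : ℕ) (j : Fin 2) : ℂ := npow (slotExpo X R (j, i) (τ (j, i))) p

/-- The assembly kernel is the product of the truncated local factors at the unit data. [cite: TaoTeravainen2021, §8 (8.17)] -/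
theorem assemblyKernel_eq_prod_dat (χ : DirichletCharacter ℂ q) (h₁ h₂ : ℕ) (η : ℝ) (x A : ℕ) (τ : Slot → ℝ) :
    assemblyKernel χ h₁ h₂ η x A τ = ∏ p ∈ Nat.primesBelow (x + 1),
      MainTerm.localE p ((shiftDiff h₁ h₂).factorization p) A (realChar χ p)
        (uDat (Real.log x) (pairScaleR η x) τ p) (vDat (Real.log x) (pairScaleR η x) τ 1 p)
        (vDat (Real.log x) (pairScaleR η x) τ 2 p) := rfl

/-- `𝔖' · M(τ) = ∏_{p ≤ x} b_p` at the unit data. [cite: TaoTeravainen2021, §8 (8.25)] -/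
theorem singular_mul_eulerTrunc_eq_prod_modelVal_dat {h₁ h₂ : ℕ} (hne : h₁ ≠ h₂) (x : ℕ) (X R : ℝ) (τ : Slot → ℝ) :
    ((Literature.NumberTheory.Sieve.singularSeriesPartial ({(h₁ : ℤ), (h₂ : ℤ)} : Finset ℤ) x : ℝ) : ℂ) *
        ∏ j : Fin 2, eulerTrunc (x + 1) (zetaSlotS X (τ (j, 0))) =
      ∏ p ∈ Nat.primesBelow (x + 1), modelVal p ((shiftDiff h₁ h₂).factorization p) (uDat X R τ p) :=
  singular_mul_eulerTrunc_eq_prod_modelVal hne x X R τ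

/-- `‖npow s n‖ ≤ 1` for `Re s ≤ 0` and every natural `n` (`npow s 0 = 1`). [folklore] -/
theorem norm_npow_le_one' {s : ℂ} (hs : s.re ≤ 0) (n : ℕ) : ‖npow s n‖ ≤ 1 := by
  rcases Nat.eq_zero_or_pos n with rfl | hn
  · simp [npow]
  · exact norm_npow_le_one hs hn

/-- `‖npow s p‖ = p^{Re s}` for `p ≥ 1`. [folklore] -/
theorem norm_npow_eq (s : ℂ) {p : ℕ} (hp : 0 < p) : ‖npow s p‖ = (p : ℝ) ^ s.re := by
  unfold npow
  rw [Complex.norm_exp, Complex.mul_re, Complex.ofReal_re, Complex.ofReal_im, mul_zero, sub_zero,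
    Real.rpow_def_of_pos (by exact_mod_cast hp), mul_comm]

/-- `Re s_k(t) ≤ 0` for all slots (`X > 0`, `R > 1`). [folklore] -/
theorem slotExpo_re_nonpos {X R : ℝ} (hX : 0 < X) (hR : 1 < R) (k : Slot) (t : ℝ) : (slotExpo X R k t).re ≤ 0 := by
  unfold slotExpo
  split_ifs
  · simp only [Complex.add_re, Complex.neg_re, Complex.ofReal_re, Complex.mul_re, Complex.re_ofNat,
      Complex.ofReal_im, Complex.im_ofNat, Complex.I_re, Complex.I_im, Complex.mul_im]
    have : 0 < X⁻¹ := by positivity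
    nlinarith
  · rw [Complex.div_ofReal_re]
    refine div_nonpos_of_nonpos_of_nonneg ?_ (Real.log_pos hR).le
    simp

/-- `‖u_p(j)‖ ≤ 1`. [folklore] -/
theorem norm_uDat_le_one {X R : ℝ} (hX : 0 < X) (hR : 1 < R) (τ : Slot → ℝ) (p : ℕ) (j : Fin 2) :
    ‖uDat X R τ p j‖ ≤ 1 :=
  norm_npow_le_one' (slotExpo_re_nonpos hX hR _ _) p

/-- `‖v_{i,p}(j)‖ ≤ 1`. [folklore] -/
theorem norm_vDat_le_one {X R : ℝ} (hX : 0 < X) (hR : 1 < R) (τ : Slot → ℝ) (i : Fin 3) (p : ℕ) (j : Fin 2) :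
    ‖vDat X R τ i p j‖ ≤ 1 :=
  norm_npow_le_one' (slotExpo_re_nonpos hX hR _ _) p

/-- `‖v_{i,p}(j)‖ = p^{-1/log R}` for a sieve slot `i ≠ 0` and `p ≥ 1`. [folklore] -/
theorem norm_vDat_eq {X R : ℝ} (τ : Slot → ℝ) {i : Fin 3} (hi : i ≠ 0) {p : ℕ} (hp : 0 < p) (j : Fin 2) :
    ‖vDat X R τ i p j‖ = (p : ℝ) ^ (-(1 / Real.log R)) := by
  unfold vDat
  rw [norm_npow_eq _ hp]
  congr 1
  unfold slotExpo
  split_ifs with h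
  · exact absurd h hi
  · rw [Complex.div_ofReal_re]
    have : ((-1 : ℂ) + 2 * π * (τ (j, i)) * I).re = -1 := by simp
    rw [this]; ring

/-- The `d`-slot exponent: `s₀(t) = -(1/X - 2πit)`. [folklore] -/
theorem slotExpo_dslot_eq (X R : ℝ) (j : Fin 2) (t : ℝ) :
    slotExpo X R (j, 0) t = -((((X⁻¹ : ℝ) : ℂ)) - 2 * π * t * I) := by
  unfold slotExpo
  split_ifs with h
  · push_cast; ring
  · exact absurd rfl h

/-- **`‖1 - u_p(j)‖ ≤ α_p = min(2, σ log p/X)`** when `1 + 2πX|τ_{j,0}| ≤ σ` (`X > 0`, `p ≥ 1`).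
[cite: TaoTeravainen2021, §8 (8.22) ("Taylor expansion")] -/
theorem norm_one_sub_uDat_le {X R : ℝ} (hX : 0 < X) (τ : Slot → ℝ) {p : ℕ} (hp : p ≠ 0) (j : Fin 2) {σ : ℝ}
    (hσ : 1 + 2 * π * X * |τ (j, 0)| ≤ σ) : ‖1 - uDat X R τ p j‖ ≤ MainTerm.alphaW σ X p := by
  obtain ⟨-, hre, hnorm⟩ := zetaSlotS_eq X (τ (j, 0)) hX
  have hu : uDat X R τ p j = (p : ℂ) ^ (-((((X⁻¹ : ℝ) : ℂ)) - 2 * π * (τ (j, 0)) * I)) := by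
    unfold uDat npow
    rw [slotExpo_dslot_eq, Complex.cpow_def_of_ne_zero (Nat.cast_ne_zero.mpr hp), ← Complex.natCast_log, mul_comm]
  rw [hu]
  refine MainTerm.norm_one_sub_natCast_cpow_neg_le_alphaW hp (by rw [hre]; positivity) (hnorm.trans ?_)
  exact div_le_div_of_nonneg_right hσ hX.le

/-- **`‖1 - v_{i,p}(j)‖ ≤ σ log p/log R`** when `1 + 2π|τ_{j,i}| ≤ σ` (`i ≠ 0`, `R > 1`, `p ≥ 1`).
[cite: TaoTeravainen2021, §8 (8.22)] -/
theorem norm_one_sub_vDat_le {X R : ℝ} (hR : 1 < R) (τ : Slot → ℝ) {i : Fin 3} (hi : i ≠ 0) {p : ℕ} (hp : p ≠ 0)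
    (j : Fin 2) {σ : ℝ} (hσ : 1 + 2 * π * |τ (j, i)| ≤ σ) :
    ‖1 - vDat X R τ i p j‖ ≤ σ * (Real.log p / Real.log R) := by
  refine (norm_one_sub_npow_sieve_le (X := X) hR j hi (τ (j, i)) hp).trans ?_
  exact mul_le_mul_of_nonneg_right hσ (div_nonneg (Real.log_natCast_nonneg p) (Real.log_pos hR).le)

/-- `‖1 - v‖ ≤ 2` for `‖v‖ ≤ 1`. [folklore] -/
theorem norm_one_sub_le_two {v : ℂ} (hv : ‖v‖ ≤ 1) : ‖1 - v‖ ≤ 2 :=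
  calc ‖1 - v‖ ≤ ‖(1 : ℂ)‖ + ‖v‖ := norm_sub_le _ _
    _ ≤ 1 + 1 := by rw [norm_one]; exact add_le_add le_rfl hv
    _ = 2 := by norm_num

/-! ### One prime against the model, at the unit data (PART 3b) -/

/-- The per-prime majorant for the generic primes:
`6 α_p p^{-1-1/Y} + 10 α_p/p² + |1+χ(p)| · 2 min(4, σ²(log p/Y)²)/p + 4σ²(log p/Y)²/p²` (`Y = log R`).
[cite: TaoTeravainen2021, §8 (8.23)–(8.25)] -/
def genericTerm (χp σ X Y : ℝ) (p : ℕ) : ℝ :=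
  6 * (MainTerm.alphaW σ X p * (p : ℝ) ^ (-(1 + 1 / Y))) + 10 * MainTerm.alphaW σ X p / (p : ℝ) ^ 2 +
    |1 + χp| * (2 * min 4 (σ ^ 2 * (Real.log p / Y) ^ 2)) / p + 4 * σ ^ 2 * (Real.log p / Y) ^ 2 / (p : ℝ) ^ 2

/-- `0 ≤ genericTerm` (`σ ≥ 0`, `X > 0`). [folklore] -/
theorem genericTerm_nonneg {χp σ X Y : ℝ} (hσ : 0 ≤ σ) (hX : 0 < X) (p : ℕ) : 0 ≤ genericTerm χp σ X Y p := by
  unfold genericTerm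
  have hα := MainTerm.alphaW_nonneg hσ hX p
  have hmin : 0 ≤ min 4 (σ ^ 2 * (Real.log p / Y) ^ 2) := le_min (by norm_num) (by positivity)
  positivity


/-- **Generic primes at the unit data**: for `p` prime with `v_H = 0`, `σ ≥ 1` dominating the box
(`1 + 2πX|τ_{j,0}| ≤ σ`, `1 + 2π|τ_{j,i}| ≤ σ`), `|χ(p)| ≤ 1`, `L ≥ 1`:
`‖E_p - b_p‖ ≤ 6 α_p p^{-1-1/log R} + 10 α_p/p² + |1+χ(p)| · 2 min(4, σ²(log p/log R)²)/p + 4σ²(log p/log R)²/p²`.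
[cite: TaoTeravainen2021, §8 (8.23)–(8.25)] -/
theorem norm_localE_sub_modelVal_dat_le {X R σ : ℝ} (hX : 0 < X) (hR : 1 < R) (hσ : 1 ≤ σ) (τ : Slot → ℝ)
    (hbox0 : ∀ j : Fin 2, 1 + 2 * π * X * |τ (j, 0)| ≤ σ)
    (hbox : ∀ (j : Fin 2) (i : Fin 3), i ≠ 0 → 1 + 2 * π * |τ (j, i)| ≤ σ)
    {p : ℕ} (hp : p.Prime) {L : ℕ} (hL : 1 ≤ L) {χp : ℝ} (hχ : |χp| ≤ 1) :
    ‖MainTerm.localE p 0 L χp (uDat X R τ p) (vDat X R τ 1 p) (vDat X R τ 2 p) - modelVal p 0 (uDat X R τ p)‖ ≤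
      genericTerm χp σ X (Real.log R) p := by
  unfold genericTerm
  have hp0n : p ≠ 0 := hp.ne_zero
  have hp0 : (0 : ℝ) < p := by exact_mod_cast hp.pos
  have hp1 : (1 : ℝ) ≤ p := by exact_mod_cast hp.one_le
  have hlogR : 0 < Real.log R := Real.log_pos hR
  set α := MainTerm.alphaW σ X p with hαdef
  set γ : ℝ := (p : ℝ) ^ (-(1 / Real.log R)) with hγdef
  set lr : ℝ := Real.log p / Real.log R with hlr
  have hα0 : 0 ≤ α := MainTerm.alphaW_nonneg (by linarith) hX p
  have hlr0 : 0 ≤ lr := div_nonneg (Real.log_natCast_nonneg p) hlogR.le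
  have hγ1 : γ ≤ 1 := Real.rpow_le_one_of_one_le_of_nonpos hp1 (by rw [neg_nonpos]; positivity)
  -- hypotheses of the abstract lemma
  have hαu : ∀ j, ‖1 - uDat X R τ p j‖ ≤ α := fun j => norm_one_sub_uDat_le hX τ hp0n j (hbox0 j)
  have hu : ∀ j, ‖uDat X R τ p j‖ ≤ 1 := fun j => norm_uDat_le_one hX hR τ p j
  have hv₁ : ∀ j, ‖vDat X R τ 1 p j‖ ≤ γ := fun j => (norm_vDat_eq τ (by decide) hp.pos j).le
  have hv₂ : ∀ j, ‖vDat X R τ 2 p j‖ ≤ γ := fun j => (norm_vDat_eq τ (by decide) hp.pos j).le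
  have h := norm_localE_sub_model_le hp.two_le hL hχ hαu hu hγ1 hv₁ hv₂
  -- the `B_j`
  have hB : ∀ j, ‖1 - vDat X R τ 1 p j‖ * ‖1 - vDat X R τ 2 p j‖ ≤ min 4 (σ ^ 2 * lr ^ 2) := by
    intro j
    refine le_min ?_ ?_
    · calc ‖1 - vDat X R τ 1 p j‖ * ‖1 - vDat X R τ 2 p j‖ ≤ 2 * 2 :=
            mul_le_mul (norm_one_sub_le_two (norm_vDat_le_one hX hR τ 1 p j)) (norm_one_sub_le_two (norm_vDat_le_one hX hR τ 2 p j))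
              (norm_nonneg _) (by norm_num)
        _ = 4 := by norm_num
    · calc ‖1 - vDat X R τ 1 p j‖ * ‖1 - vDat X R τ 2 p j‖ ≤ (σ * lr) * (σ * lr) :=
            mul_le_mul (norm_one_sub_vDat_le hR τ (by decide) hp0n j (hbox j 1 (by decide)))
              (norm_one_sub_vDat_le hR τ (by decide) hp0n j (hbox j 2 (by decide))) (norm_nonneg _) (by positivity)
        _ = σ ^ 2 * lr ^ 2 := by ring
  have hmin0 : 0 ≤ min 4 (σ ^ 2 * lr ^ 2) := le_min (by norm_num) (by positivity)
  have hminle : min 4 (σ ^ 2 * lr ^ 2) ≤ σ ^ 2 * lr ^ 2 := min_le_right _ _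
  have hBsum : ‖1 - vDat X R τ 1 p 0‖ * ‖1 - vDat X R τ 2 p 0‖ + ‖1 - vDat X R τ 1 p 1‖ * ‖1 - vDat X R τ 2 p 1‖ ≤
      2 * min 4 (σ ^ 2 * lr ^ 2) := by linarith [hB 0, hB 1]
  have hBsum0 : 0 ≤ ‖1 - vDat X R τ 1 p 0‖ * ‖1 - vDat X R τ 2 p 0‖ + ‖1 - vDat X R τ 1 p 1‖ * ‖1 - vDat X R τ 2 p 1‖ := by
    positivity
  -- `γ/p = p^{-1-1/log R}`
  have hγp : γ / p = (p : ℝ) ^ (-(1 + 1 / Real.log R)) := by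
    rw [hγdef, div_eq_iff hp0.ne', show -(1 / Real.log R) = -(1 + 1 / Real.log R) + 1 by ring, Real.rpow_add hp0,
      Real.rpow_one]
  -- the five terms
  have h1 : 6 * α * γ / p = 6 * (α * (p : ℝ) ^ (-(1 + 1 / Real.log R))) := by rw [← hγp]; ring
  have h2 : 2 * α / (p : ℝ) ^ 2 + 8 * α / (p : ℝ) ^ 3 ≤ 10 * α / (p : ℝ) ^ 2 := by
    have h3 : 8 * α / (p : ℝ) ^ 3 ≤ 8 * α / (p : ℝ) ^ 2 := by
      refine div_le_div_of_nonneg_left (by positivity) (by positivity) ?_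
      calc (p : ℝ) ^ 2 = (p : ℝ) ^ 2 * 1 := (mul_one _).symm
        _ ≤ (p : ℝ) ^ 2 * p := mul_le_mul_of_nonneg_left hp1 (by positivity)
        _ = (p : ℝ) ^ 3 := by ring
    have e : 10 * α / (p : ℝ) ^ 2 = 2 * α / (p : ℝ) ^ 2 + 8 * α / (p : ℝ) ^ 2 := by ring
    rw [e]; linarith
  have h3 : |1 + χp| * (‖1 - vDat X R τ 1 p 0‖ * ‖1 - vDat X R τ 2 p 0‖ + ‖1 - vDat X R τ 1 p 1‖ * ‖1 - vDat X R τ 2 p 1‖) / p ≤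
      |1 + χp| * (2 * min 4 (σ ^ 2 * lr ^ 2)) / p :=
    div_le_div_of_nonneg_right (mul_le_mul_of_nonneg_left hBsum (abs_nonneg _)) hp0.le
  have h4 : 2 * (‖1 - vDat X R τ 1 p 0‖ * ‖1 - vDat X R τ 2 p 0‖ + ‖1 - vDat X R τ 1 p 1‖ * ‖1 - vDat X R τ 2 p 1‖) / (p : ℝ) ^ 2 ≤
      4 * σ ^ 2 * lr ^ 2 / (p : ℝ) ^ 2 := by
    refine div_le_div_of_nonneg_right ?_ (by positivity)
    nlinarith [hBsum, hminle]
  calc _ ≤ 6 * α * γ / p + 2 * α / (p : ℝ) ^ 2 + 8 * α / (p : ℝ) ^ 3 +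
        |1 + χp| * (‖1 - vDat X R τ 1 p 0‖ * ‖1 - vDat X R τ 2 p 0‖ + ‖1 - vDat X R τ 1 p 1‖ * ‖1 - vDat X R τ 2 p 1‖) / p +
        2 * (‖1 - vDat X R τ 1 p 0‖ * ‖1 - vDat X R τ 2 p 0‖ + ‖1 - vDat X R τ 1 p 1‖ * ‖1 - vDat X R τ 2 p 1‖) / (p : ℝ) ^ 2 := h
    _ ≤ 6 * (α * (p : ℝ) ^ (-(1 + 1 / Real.log R))) + 10 * α / (p : ℝ) ^ 2 + |1 + χp| * (2 * min 4 (σ ^ 2 * lr ^ 2)) / p +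
        4 * σ ^ 2 * lr ^ 2 / (p : ℝ) ^ 2 := by rw [← h1]; linarith [h2, h3, h4]

/-- **Small primes at the unit data** (`p` prime, `p < C₀`, any `v_H`): with `σ` dominating the box,
`‖E_p - b_p‖ ≤ 480 σ log C₀/log R + 36 σ log C₀/X`. [cite: TaoTeravainen2021, §8 (the primes `p < C₀`)] -/
theorem norm_localE_sub_modelVal_dat_small_le {X R σ : ℝ} (hX : 0 < X) (hR : 1 < R) (hσ : 1 ≤ σ) (τ : Slot → ℝ)
    (hbox0 : ∀ j : Fin 2, 1 + 2 * π * X * |τ (j, 0)| ≤ σ)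
    (hbox : ∀ (j : Fin 2) (i : Fin 3), i ≠ 0 → 1 + 2 * π * |τ (j, i)| ≤ σ)
    {p : ℕ} (hp : p.Prime) {C₀ : ℕ} (hpC : p < C₀) (vH : ℕ) {L : ℕ} (hL : 1 ≤ L) {χp : ℝ} (hχ : |χp| ≤ 1) :
    ‖MainTerm.localE p vH L χp (uDat X R τ p) (vDat X R τ 1 p) (vDat X R τ 2 p) - modelVal p vH (uDat X R τ p)‖ ≤
      480 * (σ * Real.log C₀ / Real.log R) + 36 * (σ * Real.log C₀ / X) := by
  have hp0n : p ≠ 0 := hp.ne_zero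
  have hp0 : (0 : ℝ) < p := by exact_mod_cast hp.pos
  have hlogR : 0 < Real.log R := Real.log_pos hR
  have hσ0 : 0 ≤ σ := by linarith
  have hlogp : Real.log p ≤ Real.log C₀ := Real.log_le_log hp0 (by exact_mod_cast hpC.le)
  have hu : ∀ j, ‖uDat X R τ p j‖ ≤ 1 := fun j => norm_uDat_le_one hX hR τ p j
  have hv₁ : ∀ j, ‖vDat X R τ 1 p j‖ ≤ 1 := fun j => norm_vDat_le_one hX hR τ 1 p j
  have hv₂ : ∀ j, ‖vDat X R τ 2 p j‖ ≤ 1 := fun j => norm_vDat_le_one hX hR τ 2 p j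
  have hβv : ∀ j, ‖1 - vDat X R τ 1 p j‖ ≤ σ * Real.log C₀ / Real.log R := fun j =>
    calc ‖1 - vDat X R τ 1 p j‖ ≤ σ * (Real.log p / Real.log R) := norm_one_sub_vDat_le hR τ (by decide) hp0n j (hbox j 1 (by decide))
      _ ≤ σ * (Real.log C₀ / Real.log R) := mul_le_mul_of_nonneg_left (div_le_div_of_nonneg_right hlogp hlogR.le) hσ0
      _ = _ := by ring
  have hα : ∀ j, ‖1 - uDat X R τ p j‖ ≤ σ * Real.log C₀ / X := fun j =>
    calc ‖1 - uDat X R τ p j‖ ≤ MainTerm.alphaW σ X p := norm_one_sub_uDat_le hX τ hp0n j (hbox0 j)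
      _ ≤ σ * Real.log p / X := MainTerm.alphaW_le σ X p
      _ ≤ σ * Real.log C₀ / X := div_le_div_of_nonneg_right (mul_le_mul_of_nonneg_left hlogp hσ0) hX.le
  have h := norm_localE_sub_model_small_le hp.two_le vH hL hχ hu hv₁ hv₂ hβv hα
  unfold modelVal
  linarith [h]



/-! ### The sum over the generic primes (PART 3c) -/

/-- The majorant of `∑_{p ≥ C₀} d_p`: with `Y = log R`, a cut `A ≥ 1` for the `α`-sum, a cut `w ≥ 1` for the
exceptional sum and a bound `K` for `∑_{w < p exceptional} 1/p`,
`D = 6(σ(AY+2)/X + 34e^{-A}/A) + 40σ S/X + 4σ²/Y² · log w (log w + log 4) + 16K + 64σ² S/Y²`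
(`S = ∑ n^{-3/2}`). [cite: TaoTeravainen2021, §8 (8.23)–(8.25)] -/
def Dbound (σ X Y A w K : ℝ) : ℝ :=
  6 * (σ * (A * Y + 2) / X + 34 * Real.exp (-A) / A) + 40 * σ * MainTerm.rpowSum32 / X +
    4 * σ ^ 2 / Y ^ 2 * (Real.log w * (Real.log w + Real.log 4)) + 16 * K + 64 * σ ^ 2 * MainTerm.rpowSum32 / Y ^ 2

/-- **The sum of the per-prime majorants over a finite set of primes** is at most `Dbound`
(Mertens-type sums of `…MainTermSums.lean`; the primes `p ≤ w` are NOT required to be exceptional, the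
primes `p > w` with `χ(p) = -1` contribute nothing). [cite: TaoTeravainen2021, §8 (8.23)–(8.25), Corollary 3.6] -/
theorem sum_genericTerm_le (χ : DirichletCharacter ℂ q) {P : Finset ℕ} (hP : ∀ p ∈ P, p.Prime)
    {σ X Y A w K : ℝ} (hσ : 1 ≤ σ) (hX : 0 < X) (hY : 2 ≤ Y) (hA : 1 ≤ A) (hw : 1 ≤ w)
    (hexc : ∑ p ∈ P.filter (fun p : ℕ => w < p ∧ χ (p : ZMod q) ≠ -1), (1 : ℝ) / p ≤ K) :
    ∑ p ∈ P, genericTerm (realChar χ p) σ X Y p ≤ Dbound σ X Y A w K := by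
  have hY0 : 0 < Y := by linarith
  have hσ0 : 0 ≤ σ := by linarith
  have hχ2 : ∀ p : ℕ, |1 + realChar χ p| ≤ 2 := fun p => by
    have h := abs_realChar_le_one χ p
    rw [abs_le] at h ⊢
    constructor <;> linarith [h.1, h.2]
  -- term 1
  have h1 : ∑ p ∈ P, 6 * (MainTerm.alphaW σ X p * (p : ℝ) ^ (-(1 + 1 / Y))) ≤
      6 * (σ * (A * Y + 2) / X + 34 * Real.exp (-A) / A) := by
    rw [← mul_sum]
    exact mul_le_mul_of_nonneg_left (MainTerm.sum_alphaW_rpow_le_fine hP hσ0 hX hY hA) (by norm_num)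
  -- term 2
  have h2 : ∑ p ∈ P, 10 * MainTerm.alphaW σ X p / (p : ℝ) ^ 2 ≤ 40 * σ * MainTerm.rpowSum32 / X := by
    calc ∑ p ∈ P, 10 * MainTerm.alphaW σ X p / (p : ℝ) ^ 2 ≤ ∑ p ∈ P, (10 * σ / X) * (Real.log p / (p : ℝ) ^ 2) := by
          refine sum_le_sum fun p hp => ?_
          have hαle := MainTerm.alphaW_le σ X p
          calc 10 * MainTerm.alphaW σ X p / (p : ℝ) ^ 2 ≤ 10 * (σ * Real.log p / X) / (p : ℝ) ^ 2 :=
                div_le_div_of_nonneg_right (by linarith) (by positivity)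
            _ = (10 * σ / X) * (Real.log p / (p : ℝ) ^ 2) := by ring
      _ = (10 * σ / X) * ∑ p ∈ P, Real.log p / (p : ℝ) ^ 2 := by rw [mul_sum]
      _ ≤ (10 * σ / X) * (4 * MainTerm.rpowSum32) :=
          mul_le_mul_of_nonneg_left (MainTerm.sum_log_div_sq_le hP) (by positivity)
      _ = 40 * σ * MainTerm.rpowSum32 / X := by ring
  -- term 3: split at `w`
  have h3 : ∑ p ∈ P, |1 + realChar χ p| * (2 * min 4 (σ ^ 2 * (Real.log p / Y) ^ 2)) / p ≤
      4 * σ ^ 2 / Y ^ 2 * (Real.log w * (Real.log w + Real.log 4)) + 16 * K := by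
    rw [← sum_filter_add_sum_filter_not P (fun p : ℕ => (p : ℝ) ≤ w)]
    refine add_le_add ?_ ?_
    · calc ∑ p ∈ P.filter (fun p : ℕ => (p : ℝ) ≤ w), |1 + realChar χ p| * (2 * min 4 (σ ^ 2 * (Real.log p / Y) ^ 2)) / p
          ≤ ∑ p ∈ P.filter (fun p : ℕ => (p : ℝ) ≤ w), (4 * σ ^ 2 / Y ^ 2) * (Real.log p ^ 2 / p) := by
            refine sum_le_sum fun p hp => ?_
            have hpP := (mem_filter.mp hp).1
            have hp0 : (0 : ℝ) < p := by exact_mod_cast (hP p hpP).pos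
            have hmin : min 4 (σ ^ 2 * (Real.log p / Y) ^ 2) ≤ σ ^ 2 * (Real.log p / Y) ^ 2 := min_le_right _ _
            have hmin0 : 0 ≤ min 4 (σ ^ 2 * (Real.log p / Y) ^ 2) := le_min (by norm_num) (by positivity)
            calc |1 + realChar χ p| * (2 * min 4 (σ ^ 2 * (Real.log p / Y) ^ 2)) / p
                ≤ 2 * (2 * (σ ^ 2 * (Real.log p / Y) ^ 2)) / p := by
                  refine div_le_div_of_nonneg_right ?_ hp0.le
                  exact mul_le_mul (hχ2 p) (by linarith) (by positivity) (by norm_num)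
              _ = (4 * σ ^ 2 / Y ^ 2) * (Real.log p ^ 2 / p) := by ring
        _ = (4 * σ ^ 2 / Y ^ 2) * ∑ p ∈ P.filter (fun p : ℕ => (p : ℝ) ≤ w), Real.log p ^ 2 / p := by rw [mul_sum]
        _ ≤ (4 * σ ^ 2 / Y ^ 2) * (Real.log w * (Real.log w + Real.log 4)) :=
            mul_le_mul_of_nonneg_left (MainTerm.sum_log_sq_div_filter_le hP hw) (by positivity)
    · calc ∑ p ∈ P.filter (fun p : ℕ => ¬(p : ℝ) ≤ w), |1 + realChar χ p| * (2 * min 4 (σ ^ 2 * (Real.log p / Y) ^ 2)) / p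
          ≤ ∑ p ∈ P.filter (fun p : ℕ => ¬(p : ℝ) ≤ w), 16 * (if χ (p : ZMod q) = -1 then 0 else (1 : ℝ) / p) := by
            refine sum_le_sum fun p hp => ?_
            have hpP := (mem_filter.mp hp).1
            have hp0 : (0 : ℝ) < p := by exact_mod_cast (hP p hpP).pos
            split_ifs with hχp
            · have hre : realChar χ p = -1 := by unfold realChar; rw [hχp]; simp
              rw [hre]; norm_num
            · have hmin : min 4 (σ ^ 2 * (Real.log p / Y) ^ 2) ≤ 4 := min_le_left _ _
              have hmin0 : 0 ≤ min 4 (σ ^ 2 * (Real.log p / Y) ^ 2) := le_min (by norm_num) (by positivity)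
              calc |1 + realChar χ p| * (2 * min 4 (σ ^ 2 * (Real.log p / Y) ^ 2)) / p ≤ 2 * (2 * 4) / p := by
                    refine div_le_div_of_nonneg_right ?_ hp0.le
                    exact mul_le_mul (hχ2 p) (by linarith) (by positivity) (by norm_num)
                _ = 16 * (1 / p) := by ring
        _ = 16 * ∑ p ∈ P.filter (fun p : ℕ => ¬(p : ℝ) ≤ w), (if χ (p : ZMod q) = -1 then 0 else (1 : ℝ) / p) := by
            rw [mul_sum]
        _ = 16 * ∑ p ∈ P.filter (fun p : ℕ => w < p ∧ χ (p : ZMod q) ≠ -1), (1 : ℝ) / p := by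
            congr 1
            rw [sum_ite, sum_const_zero, zero_add, Finset.filter_filter]
            refine sum_congr ?_ fun _ _ => rfl
            ext p
            simp only [Finset.mem_filter, not_le, ne_eq]
        _ ≤ 16 * K := mul_le_mul_of_nonneg_left hexc (by norm_num)
  -- term 4
  have h4 : ∑ p ∈ P, 4 * σ ^ 2 * (Real.log p / Y) ^ 2 / (p : ℝ) ^ 2 ≤ 64 * σ ^ 2 * MainTerm.rpowSum32 / Y ^ 2 := by
    calc ∑ p ∈ P, 4 * σ ^ 2 * (Real.log p / Y) ^ 2 / (p : ℝ) ^ 2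
        = (4 * σ ^ 2 / Y ^ 2) * ∑ p ∈ P, Real.log p ^ 2 / (p : ℝ) ^ 2 := by
          rw [mul_sum]; exact sum_congr rfl fun p _ => by ring
      _ ≤ (4 * σ ^ 2 / Y ^ 2) * (16 * MainTerm.rpowSum32) :=
          mul_le_mul_of_nonneg_left (MainTerm.sum_log_sq_div_sq_le hP) (by positivity)
      _ = 64 * σ ^ 2 * MainTerm.rpowSum32 / Y ^ 2 := by ring
  -- combine
  unfold Dbound
  have hsplit : ∑ p ∈ P, genericTerm (realChar χ p) σ X Y p =
      ∑ p ∈ P, 6 * (MainTerm.alphaW σ X p * (p : ℝ) ^ (-(1 + 1 / Y))) + ∑ p ∈ P, 10 * MainTerm.alphaW σ X p / (p : ℝ) ^ 2 +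
        ∑ p ∈ P, |1 + realChar χ p| * (2 * min 4 (σ ^ 2 * (Real.log p / Y) ^ 2)) / p +
        ∑ p ∈ P, 4 * σ ^ 2 * (Real.log p / Y) ^ 2 / (p : ℝ) ^ 2 := by
    unfold genericTerm
    rw [← sum_add_distrib, ← sum_add_distrib, ← sum_add_distrib]
  rw [hsplit]
  linarith [h1, h2, h3, h4]

/-! ### The comparison at a fixed `τ` (PART 3d) -/

/-- **The kernel against the model at a fixed `τ`**: for `h₁ ≠ h₂`, `A ≥ 1`, `log x ≥ 2`, `1 < R` with
`log R ≥ 2`, `σ ≥ 1` dominating the box, `C₀ ≥ |h₁ − h₂| + 3` with `C₀ ≤ x`, cuts `Aℓ ≥ 1`, `w ≥ 1` and a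
bound `K` for the exceptional sum beyond `w`:
`‖∏_{p ≤ x} E_p − ∏_{p ≤ x} b_p‖ ≤ 972^{C₀} · ((2π)^4 e^{2c(C₀)} X^{-2} ∏_j(1+X|τ_{j,0}|)²) · (exp(7D) − 1 + C₀ e)`,
`e = 480 σ log C₀/log R + 36 σ log C₀/X`. [cite: TaoTeravainen2021, §8 (8.21)–(8.25)] -/
theorem norm_prod_localE_sub_prod_modelVal_dat_le (χ : DirichletCharacter ℂ q) {h₁ h₂ : ℕ} (hne : h₁ ≠ h₂)
    {A : ℕ} (hA : 1 ≤ A) {x : ℕ} (hX2 : 2 ≤ Real.log x) {R : ℝ} (hR : 1 < R) (hY : 2 ≤ Real.log R)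
    {σ : ℝ} (hσ : 1 ≤ σ) (τ : Slot → ℝ)
    (hbox0 : ∀ j : Fin 2, 1 + 2 * π * Real.log x * |τ (j, 0)| ≤ σ)
    (hbox : ∀ (j : Fin 2) (i : Fin 3), i ≠ 0 → 1 + 2 * π * |τ (j, i)| ≤ σ)
    {C₀ : ℕ} (hC₀ : shiftDiff h₁ h₂ + 3 ≤ C₀) (hC₀x : C₀ ≤ x) {Aℓ w K : ℝ} (hAℓ : 1 ≤ Aℓ) (hw : 1 ≤ w)
    (hexc : ∑ p ∈ ((Nat.primesBelow (x + 1)).filter (fun p => C₀ ≤ p)).filter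
        (fun p : ℕ => w < p ∧ χ (p : ZMod q) ≠ -1), (1 : ℝ) / p ≤ K) :
    ‖∏ p ∈ Nat.primesBelow (x + 1), MainTerm.localE p ((shiftDiff h₁ h₂).factorization p) A (realChar χ p)
          (uDat (Real.log x) R τ p) (vDat (Real.log x) R τ 1 p) (vDat (Real.log x) R τ 2 p) -
        ∏ p ∈ Nat.primesBelow (x + 1), modelVal p ((shiftDiff h₁ h₂).factorization p) (uDat (Real.log x) R τ p)‖ ≤
      972 ^ C₀ * ((2 * π) ^ 4 * Real.exp (Real.log (Real.log C₀) + 6 / Real.log C₀ + 77) ^ 2 * (Real.log x ^ 2)⁻¹ *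
          ∏ j : Fin 2, (1 + Real.log x * |τ (j, 0)|) ^ 2) *
        (Real.exp (7 * Dbound σ (Real.log x) (Real.log R) Aℓ w K) - 1 +
          C₀ * (480 * (σ * Real.log C₀ / Real.log R) + 36 * (σ * Real.log C₀ / Real.log x))) := by
  have hX0 : 0 < Real.log x := by linarith
  have hσ0 : 0 ≤ σ := by linarith
  have hPp : ∀ p ∈ Nat.primesBelow (x + 1), p.Prime := fun p hp => Nat.prime_of_mem_primesBelow hp
  have hΔ0 : shiftDiff h₁ h₂ ≠ 0 := shiftDiff_ne_zero hne
  have hC₀' : ∀ p ∈ Nat.primesBelow (x + 1), C₀ ≤ p → ¬p ∣ shiftDiff h₁ h₂ ∧ 3 ≤ p := by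
    intro p _ hCp
    refine ⟨fun hdvd => ?_, by omega⟩
    have := Nat.le_of_dvd (Nat.pos_of_ne_zero hΔ0) hdvd
    omega
  have hC₀3 : 3 ≤ C₀ := by omega
  have hC₀R : (3 : ℝ) ≤ C₀ := by exact_mod_cast hC₀3
  have hlogC₀ : 0 ≤ Real.log C₀ := Real.log_nonneg (by linarith)
  have hlogR : 0 < Real.log R := Real.log_pos hR
  -- the abstract comparison
  have hmain := norm_prod_localE_sub_prod_model_le hPp hC₀' (fun p => realChar χ p) (fun p => abs_realChar_le_one χ p)
    (uDat (Real.log x) R τ) (vDat (Real.log x) R τ 1) (vDat (Real.log x) R τ 2)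
    (fun p j => norm_uDat_le_one hX0 hR τ p j) (fun p j => norm_vDat_le_one hX0 hR τ 1 p j)
    (fun p j => norm_vDat_le_one hX0 hR τ 2 p j)
    (d := fun p => genericTerm (realChar χ p) σ (Real.log x) (Real.log R) p)
    (fun p hp hCp => by
      have hvH : (shiftDiff h₁ h₂).factorization p = 0 := Nat.factorization_eq_zero_of_not_dvd (hC₀' p hp hCp).1
      rw [hvH]
      exact norm_localE_sub_modelVal_dat_le hX0 hR hσ τ hbox0 hbox (hPp p hp) hA (abs_realChar_le_one χ p))
    (e := 480 * (σ * Real.log C₀ / Real.log R) + 36 * (σ * Real.log C₀ / Real.log x)) (by positivity)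
    (fun p hp hpC => norm_localE_sub_modelVal_dat_small_le hX0 hR hσ τ hbox0 hbox (hPp p hp) hpC _ hA (abs_realChar_le_one χ p))
  refine hmain.trans ?_
  -- the model product over the generic primes and the sum
  have hbig := norm_prod_modelVal_big_le (Δ := shiftDiff h₁ h₂) hC₀3 hC₀x hX2 (fun p hp hCp => (hC₀' p hp hCp).1) R τ
  have hsum := sum_genericTerm_le χ (P := (Nat.primesBelow (x + 1)).filter (fun p => C₀ ≤ p))
    (fun p hp => hPp p (mem_filter.mp hp).1) hσ hX0 hY hAℓ hw hexc
  have hexp : Real.exp (7 * ∑ p ∈ (Nat.primesBelow (x + 1)).filter (fun p => C₀ ≤ p),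
        genericTerm (realChar χ p) σ (Real.log x) (Real.log R) p) ≤
      Real.exp (7 * Dbound σ (Real.log x) (Real.log R) Aℓ w K) :=
    Real.exp_le_exp.mpr (mul_le_mul_of_nonneg_left hsum (by norm_num))
  have hsum0 : 0 ≤ ∑ p ∈ (Nat.primesBelow (x + 1)).filter (fun p => C₀ ≤ p),
      genericTerm (realChar χ p) σ (Real.log x) (Real.log R) p :=
    sum_nonneg fun p _ => genericTerm_nonneg hσ0 hX0 p
  have he0 : 0 ≤ (C₀ : ℝ) * (480 * (σ * Real.log C₀ / Real.log R) + 36 * (σ * Real.log C₀ / Real.log x)) := by positivity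
  have hfac0 : 0 ≤ Real.exp (7 * ∑ p ∈ (Nat.primesBelow (x + 1)).filter (fun p => C₀ ≤ p),
        genericTerm (realChar χ p) σ (Real.log x) (Real.log R) p) - 1 +
      C₀ * (480 * (σ * Real.log C₀ / Real.log R) + 36 * (σ * Real.log C₀ / Real.log x)) := by
    have h1 : 1 ≤ Real.exp (7 * ∑ p ∈ (Nat.primesBelow (x + 1)).filter (fun p => C₀ ≤ p),
        genericTerm (realChar χ p) σ (Real.log x) (Real.log R) p) := Real.one_le_exp (by positivity)
    linarith
  exact mul_le_mul (mul_le_mul_of_nonneg_left hbig (by positivity)) (by linarith [hexp]) hfac0 (by positivity)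



/-! ### Bookkeeping in `L = log η` (PART 3e) -/

/-- `L^{-a} ≤ L^{-1/14}` for `L ≥ 1`, `a ≥ 1/14`. [folklore] -/
theorem rpow_neg_le_fourteenth {L a : ℝ} (hL : 1 ≤ L) (ha : (1 : ℝ) / 14 ≤ a) : L ^ (-a) ≤ L ^ (-(1 : ℝ) / 14) :=
  Real.rpow_le_rpow_of_exponent_le hL (by linarith)

/-- The constant of the `Dbound` bookkeeping. [folklore] -/
def kb3Const (K₁ K₃₆ : ℝ) : ℝ :=
  4908 + 16 * (1 + Real.log 4) + 24 * K₁ + 80 * MainTerm.rpowSum32 * K₁ + 32 * K₃₆ + 256 * MainTerm.rpowSum32 * K₁ ^ 2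

/-- `0 ≤ kb3Const` for `K₁, K₃₆ ≥ 0`. [folklore] -/
theorem kb3Const_nonneg {K₁ K₃₆ : ℝ} (hK₁ : 0 ≤ K₁) (hK₃₆ : 0 ≤ K₃₆) : 0 ≤ kb3Const K₁ K₃₆ := by
  unfold kb3Const
  have := MainTerm.rpowSum32_nonneg
  have : 0 ≤ Real.log 4 := Real.log_nonneg (by norm_num)
  positivity

set_option maxHeartbeats 400000 in
/-- **Bookkeeping for `Dbound`** at the scales of the assembly: `L = log η ≥ max(1, 4K₁²)`, `L ≤ K₁ X`
(Siegel), `1 ≤ σ ≤ 2L^{1/200}` (the box (8.21)), `Y = X/L^{1/10}` (`= log R`), `A = L^{1/50}`,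
`log w = X/√L` (`w = x^{1/√log η}`, Corollary 3.6) and `K = K₃₆ e^{-√L/2}`:
`Dbound ≤ kb3Const(K₁, K₃₆) · L^{-1/14}`. [cite: TaoTeravainen2021, §8 (8.25)] -/
theorem kb3_Dbound_le {L X K₁ K₃₆ σ w : ℝ} (hL1 : 1 ≤ L) (hK₁ : 1 ≤ K₁) (hK₃₆ : 0 ≤ K₃₆) (hX : 0 < X)
    (hLX : L ≤ K₁ * X) (hL4 : 4 * K₁ ^ 2 ≤ L) (hσ1 : 1 ≤ σ) (hσ : σ ≤ 2 * L ^ ((1 : ℝ) / 200))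
    (hw : Real.log w = X / Real.sqrt L) :
    Dbound σ X (X / L ^ ((1 : ℝ) / 10)) (L ^ ((1 : ℝ) / 50)) w (K₃₆ * Real.exp (-Real.sqrt L / 2)) ≤
      kb3Const K₁ K₃₆ * L ^ (-(1 : ℝ) / 14) := by
  have hL0 : 0 < L := by linarith
  have hK₁0 : 0 < K₁ := by linarith
  have hσ0 : 0 < σ := by linarith
  have hrS := MainTerm.rpowSum32_nonneg
  have hlog4 : 0 ≤ Real.log 4 := Real.log_nonneg (by norm_num)
  -- two elementary exponential bounds: `e^{-A} ≤ 24/A⁴` (`A > 0`) and `e^{-m/2} ≤ 2/m` (`m > 0`)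
  have exp_neg_le_div_pow_four : ∀ {A : ℝ}, 0 < A → Real.exp (-A) ≤ 24 / A ^ 4 := by
    intro A hA
    have h := Real.pow_div_factorial_le_exp A hA.le 4
    have h24 : ((Nat.factorial 4 : ℕ) : ℝ) = 24 := by norm_num [Nat.factorial]
    rw [h24, div_le_iff₀ (by norm_num : (0 : ℝ) < 24)] at h
    rw [le_div_iff₀ (pow_pos hA 4)]
    calc Real.exp (-A) * A ^ 4 ≤ Real.exp (-A) * (Real.exp A * 24) := mul_le_mul_of_nonneg_left h (Real.exp_pos _).le
      _ = 24 * (Real.exp (-A) * Real.exp A) := by ring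
      _ = 24 := by rw [← Real.exp_add, neg_add_cancel, Real.exp_zero, mul_one]
  have exp_neg_half_le : ∀ {m : ℝ}, 0 < m → Real.exp (-m / 2) ≤ 2 / m := by
    intro m hm
    have h1 : m / 2 + 1 ≤ Real.exp (m / 2) := Real.add_one_le_exp _
    have h2 : Real.exp (-m / 2) * Real.exp (m / 2) = 1 := by
      rw [← Real.exp_add, show -m / 2 + m / 2 = 0 by ring, Real.exp_zero]
    rw [le_div_iff₀ hm]
    calc Real.exp (-m / 2) * m ≤ Real.exp (-m / 2) * (2 * Real.exp (m / 2)) :=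
          mul_le_mul_of_nonneg_left (by linarith) (Real.exp_pos _).le
      _ = 2 * (Real.exp (-m / 2) * Real.exp (m / 2)) := by ring
      _ = 2 := by rw [h2, mul_one]
  -- power algebra
  have hpow3 : ∀ a b c : ℝ, L ^ a * L ^ b / L ^ c = L ^ (a + b - c) := fun a b c => by
    rw [Real.rpow_sub hL0, Real.rpow_add hL0]
  have hpow2 : ∀ a c : ℝ, L ^ a / L ^ c = L ^ (a - c) := fun a c => by rw [Real.rpow_sub hL0]
  have hL2pow : L ^ 2 = L ^ (2 : ℝ) := (Real.rpow_two L).symm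
  have hF : ∀ {e : ℝ}, e ≤ -(1 : ℝ) / 14 → L ^ e ≤ L ^ (-(1 : ℝ) / 14) := fun he => Real.rpow_le_rpow_of_exponent_le hL1 he
  have hFpos : 0 < L ^ (-(1 : ℝ) / 14) := Real.rpow_pos_of_pos hL0 _
  -- the scales
  have hℓpos : 0 < L ^ ((1 : ℝ) / 10) := Real.rpow_pos_of_pos hL0 _
  have hApos : 0 < L ^ ((1 : ℝ) / 50) := Real.rpow_pos_of_pos hL0 _
  have hA1 : 1 ≤ L ^ ((1 : ℝ) / 50) := Real.one_le_rpow hL1 (by norm_num)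
  have hTpos : 0 < L ^ ((1 : ℝ) / 200) := Real.rpow_pos_of_pos hL0 _
  have hm0 : 0 < Real.sqrt L := Real.sqrt_pos.mpr hL0
  have hmsq : Real.sqrt L ^ 2 = L := Real.sq_sqrt hL0.le
  have hmpow : Real.sqrt L = L ^ ((1 : ℝ) / 2) := Real.sqrt_eq_rpow L
  -- `2K₁ ≤ √L`, `√L ≤ X`, `1/X ≤ K₁/L`
  have h2K : 2 * K₁ ≤ Real.sqrt L := by
    rw [show 2 * K₁ = Real.sqrt ((2 * K₁) ^ 2) from (Real.sqrt_sq (by positivity)).symm]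
    exact Real.sqrt_le_sqrt (by nlinarith)
  have hKm : K₁ ≤ Real.sqrt L := by linarith
  have hXL : L / K₁ ≤ X := by rw [div_le_iff₀ hK₁0]; linarith [mul_comm K₁ X]
  have hmX : Real.sqrt L ≤ X := by
    have h1 : Real.sqrt L * K₁ ≤ L :=
      calc Real.sqrt L * K₁ ≤ Real.sqrt L * Real.sqrt L := mul_le_mul_of_nonneg_left hKm hm0.le
        _ = L := Real.mul_self_sqrt hL0.le
    exact ((le_div_iff₀ hK₁0).mpr h1).trans hXL
  have hXinv : 1 / X ≤ K₁ / L := by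
    rw [div_le_div_iff₀ hX hL0, one_mul]; linarith [mul_comm K₁ X]
  have hXinv2 : 1 / X ^ 2 ≤ K₁ ^ 2 / L ^ 2 := by
    have := pow_le_pow_left₀ (by positivity) hXinv 2
    rwa [div_pow, div_pow, one_pow] at this
  -- `σ² ≤ 4 L^{1/100}`
  have hσ2 : σ ^ 2 ≤ 4 * L ^ ((1 : ℝ) / 100) := by
    have h := pow_le_pow_left₀ hσ0.le hσ 2
    rw [mul_pow, ← Real.rpow_mul_natCast hL0.le] at h
    norm_num at h
    exact h
  -- (t1a) `σ A / ℓ ≤ 2 L^{1/200+1/50-1/10}`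
  have t1a : σ * L ^ ((1 : ℝ) / 50) / L ^ ((1 : ℝ) / 10) ≤ 2 * L ^ (-(1 : ℝ) / 14) := by
    calc σ * L ^ ((1 : ℝ) / 50) / L ^ ((1 : ℝ) / 10) ≤ (2 * L ^ ((1 : ℝ) / 200)) * L ^ ((1 : ℝ) / 50) / L ^ ((1 : ℝ) / 10) := by
          gcongr
      _ = 2 * (L ^ ((1 : ℝ) / 200) * L ^ ((1 : ℝ) / 50) / L ^ ((1 : ℝ) / 10)) := by ring
      _ = 2 * L ^ ((1 : ℝ) / 200 + 1 / 50 - 1 / 10) := by rw [hpow3]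
      _ ≤ 2 * L ^ (-(1 : ℝ) / 14) := mul_le_mul_of_nonneg_left (hF (by norm_num)) (by norm_num)
  -- (t1b) `2σ/X ≤ 4K₁ L^{1/200-1}`
  have t1b : 2 * σ / X ≤ 4 * K₁ * L ^ (-(1 : ℝ) / 14) := by
    calc 2 * σ / X = 2 * σ * (1 / X) := by ring
      _ ≤ 2 * (2 * L ^ ((1 : ℝ) / 200)) * (K₁ / L) := mul_le_mul (by linarith) hXinv (by positivity) (by positivity)
      _ = 4 * K₁ * (L ^ ((1 : ℝ) / 200) / L) := by ring
      _ = 4 * K₁ * L ^ ((1 : ℝ) / 200 - 1) := by rw [Real.rpow_sub_one hL0.ne']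
      _ ≤ 4 * K₁ * L ^ (-(1 : ℝ) / 14) := mul_le_mul_of_nonneg_left (hF (by norm_num)) (by positivity)
  -- (t1) the first bracket's first part
  have t1 : σ * (L ^ ((1 : ℝ) / 50) * (X / L ^ ((1 : ℝ) / 10)) + 2) / X ≤ (2 + 4 * K₁) * L ^ (-(1 : ℝ) / 14) := by
    have e : σ * (L ^ ((1 : ℝ) / 50) * (X / L ^ ((1 : ℝ) / 10)) + 2) / X =
        σ * L ^ ((1 : ℝ) / 50) / L ^ ((1 : ℝ) / 10) + 2 * σ / X := by
      field_simp
    rw [e]; linarith [t1a, t1b]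
  -- (t2) `34 e^{-A}/A ≤ 816 L^{-4/50}`
  have t2 : 34 * Real.exp (-L ^ ((1 : ℝ) / 50)) / L ^ ((1 : ℝ) / 50) ≤ 816 * L ^ (-(1 : ℝ) / 14) := by
    have hA4 : (L ^ ((1 : ℝ) / 50)) ^ 4 = L ^ ((2 : ℝ) / 25) := by
      rw [← Real.rpow_mul_natCast hL0.le]; norm_num
    calc 34 * Real.exp (-L ^ ((1 : ℝ) / 50)) / L ^ ((1 : ℝ) / 50) ≤ 34 * Real.exp (-L ^ ((1 : ℝ) / 50)) / 1 :=
          div_le_div_of_nonneg_left (by positivity) one_pos hA1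
      _ ≤ 34 * (24 / (L ^ ((1 : ℝ) / 50)) ^ 4) := by rw [div_one]; exact mul_le_mul_of_nonneg_left (exp_neg_le_div_pow_four hApos) (by norm_num)
      _ = 816 * L ^ (-((2 : ℝ) / 25)) := by rw [hA4, Real.rpow_neg hL0.le]; ring
      _ ≤ 816 * L ^ (-(1 : ℝ) / 14) := mul_le_mul_of_nonneg_left (hF (by norm_num)) (by norm_num)
  -- (t3) `40 σ S/X ≤ 80 S K₁ L^{1/200 - 1}`
  have t3 : 40 * σ * MainTerm.rpowSum32 / X ≤ 80 * MainTerm.rpowSum32 * K₁ * L ^ (-(1 : ℝ) / 14) := by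
    calc 40 * σ * MainTerm.rpowSum32 / X = 40 * MainTerm.rpowSum32 * σ * (1 / X) := by ring
      _ ≤ 40 * MainTerm.rpowSum32 * (2 * L ^ ((1 : ℝ) / 200)) * (K₁ / L) :=
          mul_le_mul (mul_le_mul_of_nonneg_left hσ (by positivity)) hXinv (by positivity) (by positivity)
      _ = 80 * MainTerm.rpowSum32 * K₁ * (L ^ ((1 : ℝ) / 200) / L) := by ring
      _ = 80 * MainTerm.rpowSum32 * K₁ * L ^ ((1 : ℝ) / 200 - 1) := by rw [Real.rpow_sub_one hL0.ne']
      _ ≤ 80 * MainTerm.rpowSum32 * K₁ * L ^ (-(1 : ℝ) / 14) := mul_le_mul_of_nonneg_left (hF (by norm_num)) (by positivity)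
  -- (t4) the `w`-term
  have t4 : 4 * σ ^ 2 / (X / L ^ ((1 : ℝ) / 10)) ^ 2 * (Real.log w * (Real.log w + Real.log 4)) ≤
      16 * (1 + Real.log 4) * L ^ (-(1 : ℝ) / 14) := by
    rw [hw]
    have e : 4 * σ ^ 2 / (X / L ^ ((1 : ℝ) / 10)) ^ 2 * (X / Real.sqrt L * (X / Real.sqrt L + Real.log 4)) =
        4 * σ ^ 2 * (L ^ ((1 : ℝ) / 10)) ^ 2 * (1 / Real.sqrt L ^ 2 + Real.log 4 * (1 / (Real.sqrt L * X))) := by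
      field_simp
      try ring
    rw [e]
    have hin : 1 / Real.sqrt L ^ 2 + Real.log 4 * (1 / (Real.sqrt L * X)) ≤ (1 + Real.log 4) / L := by
      rw [hmsq]
      have h1 : 1 / (Real.sqrt L * X) ≤ 1 / L := by
        refine div_le_div_of_nonneg_left zero_le_one hL0 ?_
        calc L = Real.sqrt L * Real.sqrt L := by rw [← sq, hmsq]
          _ ≤ Real.sqrt L * X := mul_le_mul_of_nonneg_left hmX hm0.le
      have h2 : Real.log 4 * (1 / (Real.sqrt L * X)) ≤ Real.log 4 * (1 / L) := mul_le_mul_of_nonneg_left h1 hlog4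
      have e2 : (1 + Real.log 4) / L = 1 / L + Real.log 4 * (1 / L) := by ring
      rw [e2]; linarith
    have hℓ2 : (L ^ ((1 : ℝ) / 10)) ^ 2 = L ^ ((1 : ℝ) / 5) := by rw [← Real.rpow_mul_natCast hL0.le]; norm_num
    calc 4 * σ ^ 2 * (L ^ ((1 : ℝ) / 10)) ^ 2 * (1 / Real.sqrt L ^ 2 + Real.log 4 * (1 / (Real.sqrt L * X)))
        ≤ 4 * (4 * L ^ ((1 : ℝ) / 100)) * L ^ ((1 : ℝ) / 5) * ((1 + Real.log 4) / L) := by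
          rw [hℓ2]
          exact mul_le_mul (mul_le_mul_of_nonneg_right (mul_le_mul_of_nonneg_left hσ2 (by norm_num)) (by positivity)) hin
            (by positivity) (by positivity)
      _ = 16 * (1 + Real.log 4) * (L ^ ((1 : ℝ) / 100) * L ^ ((1 : ℝ) / 5) / L) := by ring
      _ = 16 * (1 + Real.log 4) * L ^ ((1 : ℝ) / 100 + 1 / 5 - 1) := by
          rw [← Real.rpow_add hL0, ← Real.rpow_sub_one hL0.ne']
      _ ≤ 16 * (1 + Real.log 4) * L ^ (-(1 : ℝ) / 14) := mul_le_mul_of_nonneg_left (hF (by norm_num)) (by positivity)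
  -- (t5) the exceptional sum
  have t5 : 16 * (K₃₆ * Real.exp (-Real.sqrt L / 2)) ≤ 32 * K₃₆ * L ^ (-(1 : ℝ) / 14) := by
    have h1 : Real.exp (-Real.sqrt L / 2) ≤ 2 / Real.sqrt L := exp_neg_half_le hm0
    have h2 : 2 / Real.sqrt L = 2 * L ^ (-((1 : ℝ) / 2)) := by rw [hmpow, Real.rpow_neg hL0.le]; ring
    calc 16 * (K₃₆ * Real.exp (-Real.sqrt L / 2)) ≤ 16 * (K₃₆ * (2 / Real.sqrt L)) :=
          mul_le_mul_of_nonneg_left (mul_le_mul_of_nonneg_left h1 hK₃₆) (by norm_num)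
      _ = 32 * K₃₆ * L ^ (-((1 : ℝ) / 2)) := by rw [h2]; ring
      _ ≤ 32 * K₃₆ * L ^ (-(1 : ℝ) / 14) := mul_le_mul_of_nonneg_left (hF (by norm_num)) (by positivity)
  -- (t6) `64 σ² S/Y² ≤ 256 S K₁² L^{1/100 + 1/5 - 2}`
  have t6 : 64 * σ ^ 2 * MainTerm.rpowSum32 / (X / L ^ ((1 : ℝ) / 10)) ^ 2 ≤
      256 * MainTerm.rpowSum32 * K₁ ^ 2 * L ^ (-(1 : ℝ) / 14) := by
    have hℓ2 : (L ^ ((1 : ℝ) / 10)) ^ 2 = L ^ ((1 : ℝ) / 5) := by rw [← Real.rpow_mul_natCast hL0.le]; norm_num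
    have e : 64 * σ ^ 2 * MainTerm.rpowSum32 / (X / L ^ ((1 : ℝ) / 10)) ^ 2 =
        64 * MainTerm.rpowSum32 * σ ^ 2 * (L ^ ((1 : ℝ) / 10)) ^ 2 * (1 / X ^ 2) := by
      field_simp
      try ring
    rw [e, hℓ2]
    calc 64 * MainTerm.rpowSum32 * σ ^ 2 * L ^ ((1 : ℝ) / 5) * (1 / X ^ 2)
        ≤ 64 * MainTerm.rpowSum32 * (4 * L ^ ((1 : ℝ) / 100)) * L ^ ((1 : ℝ) / 5) * (K₁ ^ 2 / L ^ 2) :=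
          mul_le_mul (mul_le_mul_of_nonneg_right (mul_le_mul_of_nonneg_left hσ2 (by positivity)) (by positivity)) hXinv2
            (by positivity) (by positivity)
      _ = 256 * MainTerm.rpowSum32 * K₁ ^ 2 * (L ^ ((1 : ℝ) / 100) * L ^ ((1 : ℝ) / 5) / L ^ 2) := by ring
      _ = 256 * MainTerm.rpowSum32 * K₁ ^ 2 * L ^ ((1 : ℝ) / 100 + 1 / 5 - 2) := by rw [hL2pow, hpow3]
      _ ≤ 256 * MainTerm.rpowSum32 * K₁ ^ 2 * L ^ (-(1 : ℝ) / 14) := mul_le_mul_of_nonneg_left (hF (by norm_num)) (by positivity)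
  -- combine
  unfold Dbound kb3Const
  linarith [t1, t2, t3, t4, t5, t6]

/-- **The final combination** (pure inequality): from the fixed-`τ` comparison and the bookkeeping bounds.
[folklore] -/
theorem kb3_combine {N B Xi Pr PW D D₀ F Ce E₀ M : ℝ} (hM : 0 ≤ M) (hB : 0 ≤ B) (hXi : 0 ≤ Xi) (hPr0 : 0 ≤ Pr)
    (hN : N ≤ M * (B * Xi * Pr) * (Real.exp (7 * D) - 1 + Ce)) (hD0 : 0 ≤ D) (hD : D ≤ D₀ * F) (h7 : 7 * (D₀ * F) ≤ 1)
    (hCe0 : 0 ≤ Ce) (hCe : Ce ≤ E₀ * F) (hPr : Pr ≤ PW) :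
    N ≤ M * B * (14 * D₀ + E₀) * F * Xi * PW := by
  have hPW : 0 ≤ PW := hPr0.trans hPr
  have hexp : Real.exp (7 * D) - 1 ≤ 14 * (D₀ * F) := by
    have habs : |7 * D| ≤ 1 := by rw [abs_of_nonneg (by positivity)]; linarith
    have h := Real.abs_exp_sub_one_le habs
    rw [abs_of_nonneg (by positivity : (0 : ℝ) ≤ 7 * D)] at h
    have h' := le_of_abs_le h
    linarith
  have hG : Real.exp (7 * D) - 1 + Ce ≤ (14 * D₀ + E₀) * F := by linarith
  have hG0 : 0 ≤ Real.exp (7 * D) - 1 + Ce := by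
    have := Real.one_le_exp (by positivity : 0 ≤ 7 * D); linarith
  calc N ≤ M * (B * Xi * Pr) * (Real.exp (7 * D) - 1 + Ce) := hN
    _ ≤ M * (B * Xi * PW) * ((14 * D₀ + E₀) * F) :=
        mul_le_mul (mul_le_mul_of_nonneg_left (mul_le_mul_of_nonneg_left hPr (mul_nonneg hB hXi)) hM) hG hG0
          (mul_nonneg hM (mul_nonneg (mul_nonneg hB hXi) hPW))
    _ = M * B * (14 * D₀ + E₀) * F * Xi * PW := by ring



/-- `0 ≤ Dbound` (`σ ≥ 0`, `X, Y, A > 0`, `w ≥ 1`, `K ≥ 0`). [folklore] -/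
theorem Dbound_nonneg {σ X Y A w K : ℝ} (hσ : 0 ≤ σ) (hX : 0 < X) (hY : 0 < Y) (hA : 0 < A) (hw : 1 ≤ w)
    (hK : 0 ≤ K) : 0 ≤ Dbound σ X Y A w K := by
  unfold Dbound
  have := MainTerm.rpowSum32_nonneg
  have : 0 ≤ Real.log w := Real.log_nonneg hw
  have : 0 ≤ Real.log 4 := Real.log_nonneg (by norm_num)
  positivity

/-- **Bookkeeping for the small primes**: `C (480 σ lC/(X/L^{1/10}) + 36 σ lC/X) ≤ 1032 K₁ C lC · L^{-1/14}`.
[cite: TaoTeravainen2021, §8 (the primes `p < C₀`)] -/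
theorem kb3_eterm_le {L X K₁ σ C lC : ℝ} (hL1 : 1 ≤ L) (hK₁ : 1 ≤ K₁) (hX : 0 < X) (hLX : L ≤ K₁ * X)
    (hσ1 : 1 ≤ σ) (hσ : σ ≤ 2 * L ^ ((1 : ℝ) / 200)) (hC : 0 ≤ C) (hlC : 0 ≤ lC) :
    C * (480 * (σ * lC / (X / L ^ ((1 : ℝ) / 10))) + 36 * (σ * lC / X)) ≤ 1032 * K₁ * C * lC * L ^ (-(1 : ℝ) / 14) := by
  have hL0 : 0 < L := by linarith
  have hK₁0 : 0 < K₁ := by linarith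
  have hσ0 : 0 < σ := by linarith
  have hℓpos : 0 < L ^ ((1 : ℝ) / 10) := Real.rpow_pos_of_pos hL0 _
  have hℓ1 : 1 ≤ L ^ ((1 : ℝ) / 10) := Real.one_le_rpow hL1 (by norm_num)
  have hXinv : 1 / X ≤ K₁ / L := by
    rw [div_le_div_iff₀ hX hL0, one_mul]; linarith [mul_comm K₁ X]
  have hF : L ^ ((1 : ℝ) / 200 + 1 / 10 - 1) ≤ L ^ (-(1 : ℝ) / 14) := Real.rpow_le_rpow_of_exponent_le hL1 (by norm_num)
  -- both pieces against `G = L^{1/200} L^{1/10} K₁/L`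
  have hG : σ * L ^ ((1 : ℝ) / 10) * (1 / X) ≤ 2 * K₁ * (L ^ ((1 : ℝ) / 200) * L ^ ((1 : ℝ) / 10) / L) := by
    calc σ * L ^ ((1 : ℝ) / 10) * (1 / X) ≤ (2 * L ^ ((1 : ℝ) / 200)) * L ^ ((1 : ℝ) / 10) * (K₁ / L) :=
          mul_le_mul (mul_le_mul_of_nonneg_right hσ hℓpos.le) hXinv (by positivity) (by positivity)
      _ = _ := by ring
  have h1 : σ * lC / (X / L ^ ((1 : ℝ) / 10)) = lC * (σ * L ^ ((1 : ℝ) / 10) * (1 / X)) := by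
    field_simp
  have h2 : σ * lC / X ≤ lC * (σ * L ^ ((1 : ℝ) / 10) * (1 / X)) := by
    have e : σ * lC / X = lC * (σ * 1 * (1 / X)) := by ring
    rw [e]
    exact mul_le_mul_of_nonneg_left (mul_le_mul_of_nonneg_right (mul_le_mul_of_nonneg_left hℓ1 hσ0.le) (by positivity)) hlC
  have hpow : L ^ ((1 : ℝ) / 200) * L ^ ((1 : ℝ) / 10) / L = L ^ ((1 : ℝ) / 200 + 1 / 10 - 1) := by
    rw [← Real.rpow_add hL0, ← Real.rpow_sub_one hL0.ne']
  have hG' : σ * L ^ ((1 : ℝ) / 10) * (1 / X) ≤ 2 * K₁ * L ^ (-(1 : ℝ) / 14) :=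
    hG.trans (by rw [hpow]; exact mul_le_mul_of_nonneg_left hF (by positivity))
  rw [h1]
  have h516 : C * (480 * (lC * (σ * L ^ ((1 : ℝ) / 10) * (1 / X))) + 36 * (σ * lC / X)) ≤
      C * (516 * (lC * (σ * L ^ ((1 : ℝ) / 10) * (1 / X)))) :=
    mul_le_mul_of_nonneg_left (by linarith [h2]) hC
  refine h516.trans ?_
  calc C * (516 * (lC * (σ * L ^ ((1 : ℝ) / 10) * (1 / X)))) ≤ C * (516 * (lC * (2 * K₁ * L ^ (-(1 : ℝ) / 14)))) :=
        mul_le_mul_of_nonneg_left (mul_le_mul_of_nonneg_left (mul_le_mul_of_nonneg_left hG' hlC) (by norm_num)) hC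
    _ = 1032 * K₁ * C * lC * L ^ (-(1 : ℝ) / 14) := by ring

/-- The `d`-slot box threshold. [folklore] -/
theorem boxThr_dslot (X T : ℝ) (j : Fin 2) : boxThr X T (j, 0) = T / (2 * π * X) := by
  unfold boxThr
  split_ifs with h
  · rfl
  · exact absurd rfl h

/-- The sieve-slot box threshold. [folklore] -/
theorem boxThr_sieve (X T : ℝ) (j : Fin 2) {i : Fin 3} (hi : i ≠ 0) : boxThr X T (j, i) = T / (2 * π) := by
  unfold boxThr
  split_ifs with h
  · exact absurd h hi
  · rfl

/-- **The numerical consequences of the thresholds** (Siegel's bound `log η ≤ log q + c₁`, `q ≥ 3`,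
`η ≥ exp(max(4K₁², |c₁| + log C₀ + 1, (7D₀)^{14}))`, `x ≥ q^{41/2}`): `L = log η ≥ 1`, `L ≤ K₁ log x`,
`C₀ ≤ x`, `log x ≥ 2`, `2 L^{1/10} ≤ log x` (i.e. `log R ≥ 2`) and `7 D₀ L^{-1/14} ≤ 1`. [folklore] -/
theorem kb3_numerics {c₁ D₀ η : ℝ} {q x C₀ : ℕ} (hC₀3 : 3 ≤ C₀) (hD₀ : 0 ≤ D₀)
    (hq3 : (3 : ℝ) ≤ q) (hLq : Real.log η ≤ Real.log q + c₁)
    (hη : Real.exp (max (4 * (1 + |c₁|) ^ 2) (max (|c₁| + Real.log C₀ + 1) ((7 * D₀) ^ 14))) ≤ η)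
    (hxq : (q : ℝ) ^ ((41 : ℝ) / 2) ≤ x) :
    1 ≤ Real.log η ∧ 4 * (1 + |c₁|) ^ 2 ≤ Real.log η ∧ Real.log η ≤ (1 + |c₁|) * Real.log x ∧ C₀ ≤ x ∧
      2 ≤ Real.log x ∧ (1 : ℝ) ≤ x ∧ 2 * Real.log η ^ ((1 : ℝ) / 10) ≤ Real.log x ∧
      7 * (D₀ * Real.log η ^ (-(1 : ℝ) / 14)) ≤ 1 := by
  have hc0 : 0 ≤ |c₁| := abs_nonneg c₁
  have hK₁1 : (1 : ℝ) ≤ 1 + |c₁| := by linarith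
  have hK₁0 : (0 : ℝ) < 1 + |c₁| := by linarith
  -- thresholds
  have hL₀ : max (4 * (1 + |c₁|) ^ 2) (max (|c₁| + Real.log C₀ + 1) ((7 * D₀) ^ 14)) ≤ Real.log η := by
    have := Real.log_le_log (Real.exp_pos _) hη
    rwa [Real.log_exp] at this
  have hL4 : 4 * (1 + |c₁|) ^ 2 ≤ Real.log η := (le_max_left _ _).trans hL₀
  have hLc : |c₁| + Real.log C₀ + 1 ≤ Real.log η := ((le_max_left _ _).trans (le_max_right _ _)).trans hL₀
  have hLD : (7 * D₀) ^ 14 ≤ Real.log η := ((le_max_right _ _).trans (le_max_right _ _)).trans hL₀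
  have hK2 : 1 ≤ (1 + |c₁|) ^ 2 := one_le_pow₀ hK₁1
  have hL1 : 1 ≤ Real.log η := by linarith
  have hL0 : 0 < Real.log η := by linarith
  -- `q` and `x`
  have hq0 : (0 : ℝ) < q := by linarith
  have hq1 : (1 : ℝ) ≤ q := by linarith
  have hlog3 : 1 < Real.log 3 := by
    rw [Real.lt_log_iff_exp_lt (by norm_num)]
    have := Real.exp_one_lt_d9; linarith
  have hlogq : 1 ≤ Real.log q := hlog3.le.trans (Real.log_le_log (by norm_num) hq3)
  have hqx : (q : ℝ) ≤ x :=
    calc (q : ℝ) = (q : ℝ) ^ (1 : ℝ) := (Real.rpow_one _).symm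
      _ ≤ (q : ℝ) ^ ((41 : ℝ) / 2) := Real.rpow_le_rpow_of_exponent_le hq1 (by norm_num)
      _ ≤ x := hxq
  have hx1 : (1 : ℝ) ≤ x := hq1.trans hqx
  have hx0 : (0 : ℝ) < x := by linarith
  have hXq : (41 : ℝ) / 2 * Real.log q ≤ Real.log x := by
    rw [← Real.log_rpow hq0]; exact Real.log_le_log (by positivity) hxq
  have hX2 : 2 ≤ Real.log x := by linarith
  have hX1 : 1 ≤ Real.log x := by linarith
  have hlogqx : Real.log q ≤ Real.log x := Real.log_le_log hq0 hqx
  -- Siegel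
  have hLX : Real.log η ≤ (1 + |c₁|) * Real.log x := by
    have h1 : c₁ ≤ |c₁| * Real.log x := (le_abs_self c₁).trans (le_mul_of_one_le_right hc0 hX1)
    linarith
  -- `C₀ ≤ x`
  have hC₀R : (3 : ℝ) ≤ C₀ := by exact_mod_cast hC₀3
  have hC₀x : C₀ ≤ x := by
    have h1 : Real.log C₀ < Real.log q := by linarith [le_abs_self c₁]
    have h2 : (C₀ : ℝ) < q := (Real.log_lt_log_iff (by linarith) hq0).mp h1
    exact_mod_cast (h2.le.trans hqx)
  -- `2 L^{1/10} ≤ log x`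
  have hm0 : 0 < Real.sqrt (Real.log η) := Real.sqrt_pos.mpr hL0
  have h2K : 2 * (1 + |c₁|) ≤ Real.sqrt (Real.log η) := by
    rw [show 2 * (1 + |c₁|) = Real.sqrt ((2 * (1 + |c₁|)) ^ 2) from (Real.sqrt_sq (by positivity)).symm]
    exact Real.sqrt_le_sqrt (by rw [show (2 * (1 + |c₁|)) ^ 2 = 4 * (1 + |c₁|) ^ 2 by ring]; exact hL4)
  have hℓm : Real.log η ^ ((1 : ℝ) / 10) ≤ Real.sqrt (Real.log η) := by
    rw [Real.sqrt_eq_rpow]; exact Real.rpow_le_rpow_of_exponent_le hL1 (by norm_num)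
  have hY2 : 2 * Real.log η ^ ((1 : ℝ) / 10) ≤ Real.log x := by
    have h1 : 2 * Real.log η ^ ((1 : ℝ) / 10) * (1 + |c₁|) ≤ Real.log η := by
      calc 2 * Real.log η ^ ((1 : ℝ) / 10) * (1 + |c₁|) = Real.log η ^ ((1 : ℝ) / 10) * (2 * (1 + |c₁|)) := by ring
        _ ≤ Real.sqrt (Real.log η) * Real.sqrt (Real.log η) :=
            mul_le_mul hℓm h2K (by positivity) hm0.le
        _ = Real.log η := Real.mul_self_sqrt hL0.le
    have h2 : 2 * Real.log η ^ ((1 : ℝ) / 10) * (1 + |c₁|) ≤ Real.log x * (1 + |c₁|) :=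
      h1.trans (hLX.trans_eq (mul_comm _ _))
    exact le_of_mul_le_mul_right h2 hK₁0
  -- `7 D₀ L^{-1/14} ≤ 1`
  have h7 : 7 * (D₀ * Real.log η ^ (-(1 : ℝ) / 14)) ≤ 1 := by
    have h14 : 7 * D₀ ≤ Real.log η ^ ((14 : ℕ)⁻¹ : ℝ) := by
      rw [← Real.pow_rpow_inv_natCast (by positivity : 0 ≤ 7 * D₀) (by norm_num : (14 : ℕ) ≠ 0)]
      exact Real.rpow_le_rpow (by positivity) hLD (by positivity)
    have hpos : 0 < Real.log η ^ ((14 : ℕ)⁻¹ : ℝ) := Real.rpow_pos_of_pos hL0 _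
    have e : Real.log η ^ (-(1 : ℝ) / 14) = (Real.log η ^ ((14 : ℕ)⁻¹ : ℝ))⁻¹ := by
      rw [← Real.rpow_neg hL0.le]; norm_num
    rw [e, ← mul_assoc, mul_inv_le_iff₀ hpos, one_mul]
    exact h14
  exact ⟨hL1, hL4, hLX, hC₀x, hX2, hx1, hY2, h7⟩

/-- **`KB3`: the asymptotic (8.25) for the kernel of the assembly**, in the form consumed by
`prop72_81_pair_of_kernelBounds` (`κ = 2`): for `h₁ ≠ h₂` there are `C₃, η₃` such that for every Siegel zero
of quality `η ≥ η₃`, every `x ∈ [q^{41/2}, q^{√η}]`, every truncation `A ≥ 1` and every `τ` in the box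
`|t| ≤ log^{1/200} η`,
`‖K(τ) − 𝔖'_x ∏_j ∏_{p ≤ x}(1 − p^{-s(τ_{j,0})})‖ ≤ C₃ log^{-1/14} η · log^{-2} x · P₂(τ)`.
[cite: TaoTeravainen2021, §8 (8.21)–(8.25)] -/
theorem kernel_KB3 : ∀ h₁ h₂ : ℕ, 1 ≤ h₁ → 1 ≤ h₂ → h₁ ≠ h₂ →
    ∃ κ : ℕ, 2 ≤ κ ∧ ∃ C₃ η₃ : ℝ, 0 ≤ C₃ ∧
      ∀ (q : ℕ) [NeZero q] (χ : DirichletCharacter ℂ q) (η : ℝ), IsSiegelZero χ η → η₃ ≤ η →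
        ∀ x : ℕ, (q : ℝ) ^ ((41 : ℝ) / 2) ≤ x → (x : ℝ) ≤ (q : ℝ) ^ Real.sqrt η →
          ∀ A : ℕ, 1 ≤ A → ∀ τ : Slot → ℝ,
            (∀ k, |τ k| ≤ boxThr (Real.log x) ((Real.log η) ^ ((1 : ℝ) / 200)) k) →
              ‖assemblyKernel χ h₁ h₂ η x A τ -
                  ((Literature.NumberTheory.Sieve.singularSeriesPartial ({(h₁ : ℤ), (h₂ : ℤ)} : Finset ℤ) x : ℝ) : ℂ) *
                    ∏ j : Fin 2, eulerTrunc (x + 1) (zetaSlotS (Real.log x) (τ (j, 0)))‖ ≤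
                C₃ * (Real.log η) ^ (-(1 : ℝ) / 14) * ((Real.log x) ^ 2)⁻¹ * polyWeight (Real.log x) κ τ := by
  intro h₁ h₂ _ _ hne
  classical
  -- constants depending on `h₁, h₂` only
  obtain ⟨c₁, hc₁⟩ := exists_log_le_mul_log_conductor_add one_pos
  obtain ⟨K₃₆, η₀, h36⟩ :=
    Literature.NumberTheory.LFunctions.SiegelZero.TaoTeravainen2021_cor36_i_holds 40 (by norm_num)
  obtain ⟨C₀, hC₀def⟩ : ∃ C₀ : ℕ, C₀ = shiftDiff h₁ h₂ + 3 := ⟨_, rfl⟩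
  obtain ⟨K₁, hK₁def⟩ : ∃ K₁ : ℝ, K₁ = 1 + |c₁| := ⟨_, rfl⟩
  obtain ⟨K', hK'def⟩ : ∃ K' : ℝ, K' = max K₃₆ 0 := ⟨_, rfl⟩
  obtain ⟨D₀, hD₀def⟩ : ∃ D₀ : ℝ, D₀ = kb3Const K₁ K' := ⟨_, rfl⟩
  have hπ := Real.pi_gt_three
  have hC₀3 : 3 ≤ C₀ := by omega
  have hC₀R : (3 : ℝ) ≤ C₀ := by exact_mod_cast hC₀3
  have hlogC₀ : 0 ≤ Real.log C₀ := Real.log_nonneg (by linarith)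
  have hK₁1 : 1 ≤ K₁ := by rw [hK₁def]; have := abs_nonneg c₁; linarith
  have hK' : 0 ≤ K' := by rw [hK'def]; exact le_max_right _ _
  have hK'K : K₃₆ ≤ K' := by rw [hK'def]; exact le_max_left _ _
  have hD₀ : 0 ≤ D₀ := by rw [hD₀def]; exact kb3Const_nonneg (by linarith) hK'
  refine ⟨2, le_rfl,
    972 ^ C₀ * ((2 * π) ^ 4 * Real.exp (Real.log (Real.log C₀) + 6 / Real.log C₀ + 77) ^ 2) *
      (14 * D₀ + 1032 * K₁ * C₀ * Real.log C₀),
    max η₀ (Real.exp (max (4 * (1 + |c₁|) ^ 2) (max (|c₁| + Real.log C₀ + 1) ((7 * D₀) ^ 14)))),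
    by positivity, fun q _ χ η hS hη x hxq hxη A hA τ hτ => ?_⟩
  -- the numerical consequences of the thresholds
  have hη₀ : η₀ ≤ η := (le_max_left _ _).trans hη
  have hq3 : (3 : ℝ) ≤ q := by exact_mod_cast hS.three_le
  have hLq : Real.log η ≤ Real.log q + c₁ := by have h := hc₁ q χ η hS; rwa [one_mul] at h
  obtain ⟨hL1, hL4, hLX, hC₀x, hX2, hx1, hY2', h7⟩ :=
    kb3_numerics hC₀3 hD₀ hq3 hLq ((le_max_right _ _).trans hη) hxq
  rw [← hK₁def] at hL4 hLX
  have hL0 : 0 < Real.log η := lt_of_lt_of_le one_pos hL1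
  have hx0 : (0 : ℝ) < x := lt_of_lt_of_le one_pos hx1
  have hX0 : 0 < Real.log x := lt_of_lt_of_le two_pos hX2
  -- the scales `ℓ = L^{1/10}`, `R`, `log R = log x/ℓ ≥ 2`
  have hℓpos : 0 < Real.log η ^ ((1 : ℝ) / 10) := Real.rpow_pos_of_pos hL0 _
  have hR1 : 1 < pairScaleR η x := Real.one_lt_rpow (lt_of_lt_of_le (by norm_num) (hq3.trans ?_)) (one_div_pos.mpr hℓpos)
  swap
  · calc (q : ℝ) = (q : ℝ) ^ (1 : ℝ) := (Real.rpow_one _).symm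
      _ ≤ (q : ℝ) ^ ((41 : ℝ) / 2) := Real.rpow_le_rpow_of_exponent_le (by linarith) (by norm_num)
      _ ≤ x := hxq
  have hlogR : Real.log (pairScaleR η x) = Real.log x / Real.log η ^ ((1 : ℝ) / 10) := by
    rw [pairScaleR, Real.log_rpow hx0]; ring
  have hY2 : 2 ≤ Real.log (pairScaleR η x) := by rw [hlogR, le_div_iff₀ hℓpos]; exact hY2'
  -- `σ = 1 + T'` dominates the box
  have hT1 : 1 ≤ Real.log η ^ ((1 : ℝ) / 200) := Real.one_le_rpow hL1 (by norm_num)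
  have hσ1 : (1 : ℝ) ≤ 1 + Real.log η ^ ((1 : ℝ) / 200) := by linarith only [hT1]
  have hσ2 : 1 + Real.log η ^ ((1 : ℝ) / 200) ≤ 2 * Real.log η ^ ((1 : ℝ) / 200) := by linarith only [hT1]
  have hbox0 : ∀ j : Fin 2, 1 + 2 * π * Real.log x * |τ (j, 0)| ≤ 1 + Real.log η ^ ((1 : ℝ) / 200) := by
    intro j
    have h := hτ (j, 0)
    rw [boxThr_dslot, le_div_iff₀ (by positivity)] at h
    linarith only [h]
  have hbox : ∀ (j : Fin 2) (i : Fin 3), i ≠ 0 → 1 + 2 * π * |τ (j, i)| ≤ 1 + Real.log η ^ ((1 : ℝ) / 200) := by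
    intro j i hi
    have h := hτ (j, i)
    rw [boxThr_sieve _ _ _ hi, le_div_iff₀ (by positivity)] at h
    linarith only [h]
  -- the cut `w = x^{1/√L}` and the exceptional sum (Corollary 3.6 with `ε = 40`)
  have hw1 : 1 ≤ (x : ℝ) ^ (1 / Real.sqrt (Real.log η)) := Real.one_le_rpow hx1 (by positivity)
  have hw : Real.log ((x : ℝ) ^ (1 / Real.sqrt (Real.log η))) = Real.log x / Real.sqrt (Real.log η) := by
    rw [Real.log_rpow hx0]; ring
  have hA1 : 1 ≤ Real.log η ^ ((1 : ℝ) / 50) := Real.one_le_rpow hL1 (by norm_num)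
  have hexc : ∑ p ∈ ((Nat.primesBelow (x + 1)).filter (fun p => C₀ ≤ p)).filter
      (fun p : ℕ => (x : ℝ) ^ (1 / Real.sqrt (Real.log η)) < p ∧ χ (p : ZMod q) ≠ -1), (1 : ℝ) / p ≤
        K' * Real.exp (-Real.sqrt (Real.log η) / 2) := by
    have hxq' : (q : ℝ) ^ ((1 + 40 : ℝ) / 2) ≤ x := by norm_num; exact hxq
    have h := h36 q χ hS.1 hS.2.1 η hη₀ hS.2.2.2 (x : ℝ) hxq' hxη
    rw [Nat.floor_natCast] at h
    have hsub : ((Nat.primesBelow (x + 1)).filter (fun p => C₀ ≤ p)).filter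
        (fun p : ℕ => (x : ℝ) ^ (1 / Real.sqrt (Real.log η)) < p ∧ χ (p : ZMod q) ≠ -1) ⊆
        Literature.NumberTheory.LFunctions.SiegelZero.excPrimes χ
          (Icc ⌈(x : ℝ) ^ (1 / Real.sqrt (Real.log η))⌉₊ x) := by
      intro p hp
      simp only [Finset.mem_filter] at hp
      obtain ⟨⟨hpP, -⟩, hwp, hχp⟩ := hp
      have hpx : p < x + 1 := (Nat.mem_primesBelow.mp hpP).1
      refine Literature.NumberTheory.LFunctions.SiegelZero.mem_excPrimes.mpr
        ⟨?_, Nat.prime_of_mem_primesBelow hpP, hχp⟩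
      exact mem_Icc.mpr ⟨Nat.ceil_le.mpr hwp.le, by omega⟩
    calc _ ≤ ∑ p ∈ Literature.NumberTheory.LFunctions.SiegelZero.excPrimes χ
            (Icc ⌈(x : ℝ) ^ (1 / Real.sqrt (Real.log η))⌉₊ x), (1 : ℝ) / p :=
          sum_le_sum_of_subset_of_nonneg hsub fun p _ _ => by positivity
      _ ≤ K₃₆ * Real.exp (-Real.sqrt (Real.log η) / 2) := h
      _ ≤ K' * Real.exp (-Real.sqrt (Real.log η) / 2) := mul_le_mul_of_nonneg_right hK'K (Real.exp_pos _).le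
  -- the fixed-`τ` comparison
  have hfix := norm_prod_localE_sub_prod_modelVal_dat_le χ hne hA hX2 hR1 hY2 hσ1 τ hbox0 hbox
    (le_of_eq hC₀def.symm) hC₀x hA1 hw1 hexc
  rw [hlogR] at hfix
  -- bookkeeping
  have hDb := kb3_Dbound_le hL1 hK₁1 hK' hX0 hLX hL4 hσ1 hσ2 hw
  rw [← hD₀def] at hDb
  have hDb0 : 0 ≤ Dbound (1 + Real.log η ^ ((1 : ℝ) / 200)) (Real.log x) (Real.log x / Real.log η ^ ((1 : ℝ) / 10))
      (Real.log η ^ ((1 : ℝ) / 50)) ((x : ℝ) ^ (1 / Real.sqrt (Real.log η))) (K' * Real.exp (-Real.sqrt (Real.log η) / 2)) :=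
    Dbound_nonneg (zero_le_one.trans hσ1) hX0 (div_pos hX0 hℓpos) (lt_of_lt_of_le one_pos hA1) hw1
      (mul_nonneg hK' (Real.exp_pos _).le)
  have hCe := kb3_eterm_le (C := (C₀ : ℝ)) (lC := Real.log C₀) hL1 hK₁1 hX0 hLX hσ1 hσ2 (by positivity) hlogC₀
  have hCe0 : 0 ≤ (C₀ : ℝ) * (480 * ((1 + Real.log η ^ ((1 : ℝ) / 200)) * Real.log C₀ / (Real.log x / Real.log η ^ ((1 : ℝ) / 10))) +
      36 * ((1 + Real.log η ^ ((1 : ℝ) / 200)) * Real.log C₀ / Real.log x)) := by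
    have : 0 ≤ 1 + Real.log η ^ ((1 : ℝ) / 200) := zero_le_one.trans hσ1
    positivity
  have hPr := (prod_sq_le_polyWeight hX0.le (le_refl 2) τ).2
  -- combine
  rw [assemblyKernel_eq_prod_dat, singular_mul_eulerTrunc_eq_prod_modelVal_dat hne x (Real.log x) (pairScaleR η x) τ]
  exact kb3_combine (by positivity) (by positivity) (by positivity) (prod_nonneg fun j _ => by positivity)
    hfix hDb0 hDb h7 hCe0 hCe hPr


end TaoTeravainen

end Literature.Barriers.Parity
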